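import Summits.SmoothPoincare4.SmoothPoincare4.Theses.EntropyRung
import Literature.Geometry.Riemannian.ChangGurskyYangProofs
import Literature.Geometry.Riemannian.ShrinkingRoundSphereFour
import Literature.Geometry.Riemannian.PerelmanNoncollapsingAssembly
import Literature.Geometry.Riemannian.PerelmanNoncollapsingInterior
import Literature.Geometry.Riemannian.MetricCutoff
import Literature.Geometry.Riemannian.CanonicalNeighbourhoodsProofs
import Literature.Geometry.Riemannian.RicciFlowScalarCurvatureHolds
import Literature.Geometry.Riemannian.RicciFlowMaximal
import Literature.Geometry.Riemannian.CanonicalNeighbourhoods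
import Literature.Topology.FourManifolds.WhitneyModelSheets

/-!
# Disproof of `SubcylindricalRecognition` (crux stmt-SmoothPoincare4-10869, route EntropyRung) — standing-adversary work file

Crux (RUNG): `M ≃ₕ S⁴` closed smooth, `g` Riemannian with Levi-Civita connection, `R_g > 0`,
`ν(g) > ν_cyl := log 2 + ½ log π − 3/2 = log Θ(S³×ℝ)` (typed: `∃ δ > 0 ∀ τ > 0 ∀ f` smooth normalised,
`ν_cyl + δ ≤ 𝒲(g,f,τ)`) ⟹ `Nonempty (M ≃ₘ S⁴)`.

## VERDICT (cycle 3, 2026-08-16): RESISTS — no kill is possible short of ¬SPC4; the picked line's five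
## registered stubs (reshape r2) survive every cheap attack, one of them is PROVED here (§8.4), one is
## SPC4-trivialisable on its only use (§8.1), and the `κ`-noncollapsing plumbing of three of them is
## shown redundant (§8.2).
`spc4_imp : SmoothPoincare4 → SubcylindricalRecognition` (§1): the crux is the summit's conclusion under extra
metric hypotheses, so every counterexample is an exotic 4-sphere (carrying a PSC metric with ν > ν_cyl);
`recognition_iff_noExotic` states this exotic-free form. All threshold / hypothesis-side mutations that keep
`M ≃ₕ S⁴ → … → M ≅ S⁴` are SPC4-implied as well (§1–§2), hence unrefutable by construction.

## FINDINGS INDEX (what a prover / ideator / planner can USE from this file)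
* §1 SHAPE: `Recognition c` (generic threshold), `recognition_nuCyl_iff` (c = ν_cyl is the crux, `Iff.rfl`),
  `recognition_mono` (raising the threshold weakens the claim), `spc4_imp_recognition`, `spc4_imp`,
  `recognition_iff_noExotic` (RUNG ⟺ no super-cylindrical PSC metric on a fake S⁴).
* §2 LOAD-BEARING HYPOTHESES ("any proof must use H" / "H is decoration"):
  - `recognitionWithoutHomotopyEquiv_false`: dropping `M ≃ₕ S⁴` is FALSE as typed — but only through the junk
    witness `M = Empty` (every hypothesis vacuous, `Nonempty (Empty ≃ₘ S⁴)` false). With `Nonempty M`,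
    `ConnectedSpace M` instead of `≃ₕ S⁴` NO counterexample is known (`ConnectedRecognition`, docstring: every
    closed model in the 4-d density table sits below Θ_cyl = .791 except S⁴ itself) — information for the
    planner: the homotopy hypothesis is plausibly removable, not load-bearing for truth, only for the proof
    (it is where CompactShrinkerGap enters).
  - `spc4_imp_withoutPSC`, `spc4_imp_withoutEntropy`, `withoutMetric_iff_spc4`, `withoutCompact_iff`,
    `spc4_imp_recognitionAtLeast` (non-strict `ν ≥ c`, no uniform δ): no hypothesis-side mutation is refutable;
    `R > 0` is informally near-idle for TRUTH (ν(g) > −∞ ⇒ λ(g) > 0 ⇒ finite singular time anyway) but is USED by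
    the type-split line (scalar pinching); the STRICT `>` and the uniform δ are needed by the MECHANISM only
    (with `≥` the cylinder S³×ℝ itself is an admissible tangent flow and nothing can be concluded).
* §3 CERTIFIED WINDOW ARITHMETIC (sorry-free real-number lemmas the gap items 10868/10870 quote):
  `thetaCyl = 2√π e^{-3/2}` (.7910), `thetaSph = 6/e²` (.8120), `thetaS2R2 = 2/e` (.7358), `thetaCP2 = 9/(2e²)`
  (.6090), `thetaS2S2 = 4/e²` (.5413), `thetaEinsteinNonround = 2/e²` (.2707, Gursky bound on a homotopy S⁴);
  the chain `thetaS2S2 < thetaCP2 < thetaFIK < thetaS2R2 < thetaCyl < thetaSph < 1` (`thetaFIK = (1+√2)e^{√2−2}/2`,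
  the CLOSED FORM of FIK's density found this cycle: toric `min_a e^a(1/a+1/a²)e^{−2}` at `a = √2`),
  `thetaSph_half_lt_thetaCyl` (ℝP⁴ and all quotients below the cylinder), `half_lt_thetaCyl` (orbifold models,
  Θ ≤ 1/|Γ| ≤ 1/2, are excluded with margin .291), `thetaEinsteinNonround_lt_thetaCyl` (Einstein case of the
  compact gap has margin .52), `nuCyl_eq_log_thetaCyl`, `log_thetaSph` (ν_round = log 6 − 2), `nuCyl_lt_nuRound`
  (the round S⁴ clears the threshold; margin .02625), `routeConstant_eq` (32π²√π e^{-3/2} = 16π²·Θ_cyl, the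
  literal constant of items 10868/10870), `volRatio_window` (an EINSTEIN metric on a homotopy S⁴ has
  Θ = thetaSph·Vol/Vol_round by Bishop, so Θ > Θ_cyl needs Vol/Vol_round > Θ_cyl/Θ_sph = √(πe)/3 ∈ (.974,.9742)).
* §4 NON-VACUITY: `roundSphere_psc` — the round S⁴ ⊂ ℝ⁵ carries, WITH THE TREE'S DEFINITIONS, a C^∞ Riemannian
  metric with Levi-Civita instance and R = 12 > 0 (PROVED from `scalarCurvature_roundMetric_pos`,
  `hasLeviCivita`; axioms propext/choice/Quot.sound only). The entropy clause on the round S⁴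
  (`roundSphere_entropyAbove_nuCyl`, ν = log 6 − 2 > ν_cyl) is the one `sorry` of this file (NEAR-MISS §5): it is
  exactly item 10871 restricted to S⁴ and needs Perelman (T2) + Carrillo–Ni / the sharp LSI on S⁴, absent.
* §5 NEAR-MISSES (sorried, documented): `roundSphere_entropyAbove_nuCyl`.
* §6 MECHANISM NOTES (docstring `mechanism_notes`): what would kill the PROOF but not the statement; the
  computation record (toric Kähler shrinker densities, cycle 1, kit job j006074; cycle-2 re-certification) and the
  literature state.
* §8 TARGETS = the five registered stubs of the PICKED line `ancient-sphere-rigidity`, reshape r2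
  (skeleton sha 90cf9aa3e986…; `stub_singularFlow`, `stub_pointPicking`, `stub_rescaledSequence`,
  `stub_blowdown`, `stub_compactModelRecognition`, restated VERBATIM as `Stub…` Props — a regression guard
  that they elaborate against the current Literature):
  - 8.1 DECOUPLING: `BlowdownConclusion M` (the conclusion of `stub_blowdown`, which never mentions the
    blow-up data) holds OUTRIGHT on any `M ≅ S⁴` with the round shrinker `S⁴(√6)` as witness
    (`blowdownConclusion_of_sphereDiffeo`, `blowdownConclusion_sphere`, `stubBlowdown_onSphere`,
    `spc4_imp_blowdownConclusion`; sorry-free, via the tree's new `ShrinkingRoundSphereFour.lean`): the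
    Bamler stub is SPC4-trivialisable on its one use (`M ≃ₕ S⁴`) exactly like the crux — its content lives on
    the `M` where SPC4 is open; no cheap kill, no cheap proof.
  - 8.2 REDUNDANCY: `isKappaNoncollapsed_of_muFloor` — a uniform floor `m ≤ μ(g t, τ)` (all `τ > 0`) on the
    slices of ANY family on a closed manifold gives `κ(m, dim)`-noncollapsing at EVERY scale (Topping 8.3.4 run
    on one slice: `entropyDichotomy_of_le_muEntropy` + `exists_metric_cutoff` + halving); hence hypothesis (6)
    of `stub_blowdown` follows from (2),(3),(7) (`stubBlowdown_nlc_of_floor`, all scales, one `κ(δ')` for all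
    `k` and all `M`), and the NLC clauses of `stub_singularFlow` (Perelman Thm 4.1) / `stub_rescaledSequence`
    are not needed by the chain: the crux's floor IS a no-local-collapsing statement.
  - 8.3 TIGHTNESS at the round sphere: `roundSphere_const_compatible_and_W` (`f ≡ log 6` is compatible at
    `τ = 1/6` and `𝒲 = log 6 − 2`, from `Vol(S⁴) = 8π²/3` + `R = 12`, both now in the tree),
    `roundSphere_gap_le` (any threshold-plus-gap the round `S⁴` clears is `≤ log 6 − 2`, i.e.
    `μ(g_{S⁴}, 1/6) ≤ log 6 − 2` in the crux's typing), `entropyAbove_round_lt`, `not_entropyAbove_round_nuRound`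
    (NO gap is admissible at threshold `ν_round`: small-model refutation of raising the threshold to the
    sphere's own value for the round witness), `roundSphere_cruxGap_le` + `gap_window`
    (`0.0258 < log 6 − 2 − ν_cyl < 0.0267`: the crux's `δ` for the round metric is `< 0.0267`).
  - 8.4 THREE STUBS PROVED: `stub_pointPicking` (PointPicking.lean, attached), `stub_rescaledSequence`
    (RescaledSequence.lean, attached; via the new tree file PerelmanEntropyScaling.lean = μ scale invariance,
    which the tree lacked), and `stubCompactModelRecognition_holds`: the registered stub `stub_compactModelRecognition` is PROVED
    (injective immersion of a closed 4-manifold into a connected one is a diffeomorphism: tree IFT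
    `isLocalDiffeomorphAt_of_mfderiv_injective` + clopen range + `IsLocalDiffeomorph.diffeomorphOfBijective`);
    also attached to the item as `CompactModelRecognition.lean` in the skeleton's own namespace for the lead.
  - 8.5 per-stub attack record (docstrings of `StubSingularFlow`, `StubPointPicking`, `StubRescaledSequence`,
    `StubBlowdown`): junk models tried and why each fails, clauses possibly unnecessary, in-print anchors.
* §7 `RecognitionFrom H` / `spc4_imp_anyHyp` (SPC4 ⇒ the crux with ANY hypothesis package: the licence to move `g`),
  `recognition_eq_recognitionFrom`, and the cycle-1 names `iff_exoticFree`, `false_without_homotopyEquiv`, `gRound_psc`.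
* LANDED (sorry-free extracts, importable): `Theorems/SubcylindricalRecognition/Negative/Shape.lean` (p70136; rev 2
  p70802 adds §7's `RecognitionFrom`/`spc4_imp_anyHyp`) and `Theorems/SubcylindricalRecognition/Negative/WindowArithmetic.lean`
  (p70144; rev 2 p70801 adds `thetaFIK` lemmas and `thetaSph_half_lt_thetaCyl`), namespace
  `Summit.SmoothPoincare4.SmoothPoincare4.Theorems.SubcylindricalRecognition.Negative` — everything in §0–§4 and §7 of this
  file except the Empty-instance globals is importable from there.

## HISTORY
cycle 3 (refuter-cdisprove-…-10869-g3-0, 2026-08-16): line `ancient-sphere-rigidity` picked and reshaped (r2,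
five stubs); §8 Targets added (decoupling of `stub_blowdown`, floor ⇒ NLC redundancy, round-sphere tightness
window, PROOF of `stub_compactModelRecognition`), §6 notes 10–13; imports += ShrinkingRoundSphereFour,
PerelmanNoncollapsing{Assembly,Interior}, MetricCutoff, CanonicalNeighbourhoods(Proofs), RicciFlowMaximal,
RicciFlowScalarCurvatureHolds, WhitneyModelSheets.
cycle 1 (refuter-cdisprove-…-10869-0, 2026-08-15T22:22–22:57Z): shape, load-bearing, window arithmetic,
toric density computation (Θ(BCCD) = .5617 NEW, FIK .672, Koiso–Cao .518, Wang–Zhu .455; with Li–Wang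
arXiv:2301.09784 Thm 1.1 every non-flat complete KÄHLER shrinker of real dimension 4 has Θ ≤ 2/e < Θ_cyl).
cycle 2 (this file, refuter-cdisprove-…-10869-g2-0): cycle-1 file was attached as item evidence only and is not
readable from later jails, so it is REBUILT here from its evidence notes and EXTENDED (§2 non-strict/pointwise
variants and the Connected variant, §3 orbifold / Gursky / Bishop-window lemmas, §6 notes), and PUBLISHED to the
crux tree (`Cruxes/SubcylindricalRecognition/Disproof.lean`) so that `disproof_path` resolves for every seat.
-/

noncomputable section

set_option linter.dupNamespace false

namespace Summit.SmoothPoincare4.SmoothPoincare4.Cruxes.SubcylindricalRecognition.Disproof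

open scoped Manifold ContDiff Topology ContinuousMap ENNReal NNReal
open MeasureTheory Set Literature.Geometry.Lorentzian Literature.Geometry.Riemannian
open Summit.SmoothPoincare4.SmoothPoincare4.Theses.EntropyRung

/-! ## §0 Vocabulary -/

/-- The standard smooth 4-sphere of the summit statement. -/
local notation "𝕊⁴" => (Metric.sphere (0 : EuclideanSpace ℝ (Fin 5)) 1)

/-- The metric type of the crux: a `C^∞` pseudo-Riemannian metric on `TM`, `M` modelled on `ℝ⁴`. -/
abbrev Metric4 (M : Type) [TopologicalSpace M] [ChartedSpace (EuclideanSpace ℝ (Fin 4)) M]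
    [IsManifold (𝓡 4) ∞ M] : Type :=
  PseudoRiemannianMetric (𝓡 4) ∞ (EuclideanSpace ℝ (Fin 4)) (TangentSpace (𝓡 4) : M → Type _)

/-- The cylinder threshold `ν_cyl = log Θ(S³×ℝ) = log 2 + ½ log π − 3/2 ≈ −0.23449` (literal of the crux). -/
def nuCyl : ℝ := Real.log 2 + Real.log Real.pi / 2 - 3 / 2

section Hyp

variable {M : Type} [TopologicalSpace M] [ChartedSpace (EuclideanSpace ℝ (Fin 4)) M]
  [IsManifold (𝓡 4) ∞ M] [T3Space M] [MeasurableSpace M] [BorelSpace M]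

/-- `EntropyAbove g hg c`: the crux's typed form of "ν(g) > c" — a UNIFORM gap δ > 0 below Perelman's
`𝒲(g,f,τ) = ∫ [τ(R + |∇f|²) + f − 4] (4πτ)⁻² e^{−f} dV` over all scales τ > 0 and all smooth `f` with
`∫ (4πτ)⁻² e^{−f} dV = 1`, `dV = riemannianMeasure (g.toContMDiffRiemannianMetric hg)`. For `c = nuCyl` this is
the entropy hypothesis of `SubcylindricalRecognition` verbatim. -/
def EntropyAbove (g : Metric4 M) [g.HasLeviCivita] (hg : g.IsRiemannian) (c : ℝ) : Prop :=
  ∃ δ : ℝ, 0 < δ ∧ ∀ τ : ℝ, 0 < τ → ∀ f : M → ℝ, ContMDiff (𝓡 4) 𝓘(ℝ, ℝ) ∞ f →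
    ∫ x, (4 * Real.pi * τ) ^ (-(4 : ℝ) / 2) * Real.exp (-f x)
        ∂(riemannianMeasure (g.toContMDiffRiemannianMetric hg)) = 1 →
      c + δ ≤ ∫ x, (τ * (g.scalarCurvature x + g.gradSq f x) + f x - 4) *
        ((4 * Real.pi * τ) ^ (-(4 : ℝ) / 2) * Real.exp (-f x))
          ∂(riemannianMeasure (g.toContMDiffRiemannianMetric hg))

/-- `EntropyAtLeast g hg c`: the NON-STRICT, NON-UNIFORM variant "μ(g,τ) ≥ c for every τ > 0" (no δ). Weaker
hypothesis ⇒ the corresponding recognition statement is STRONGER; it is still SPC4-implied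
(`spc4_imp_recognitionAtLeast`), but the MECHANISM dies: with `c = ν_cyl` the round cylinder S³×ℝ
(log Θ = ν_cyl exactly) becomes an admissible tangent flow. -/
def EntropyAtLeast (g : Metric4 M) [g.HasLeviCivita] (hg : g.IsRiemannian) (c : ℝ) : Prop :=
  ∀ τ : ℝ, 0 < τ → ∀ f : M → ℝ, ContMDiff (𝓡 4) 𝓘(ℝ, ℝ) ∞ f →
    ∫ x, (4 * Real.pi * τ) ^ (-(4 : ℝ) / 2) * Real.exp (-f x)
        ∂(riemannianMeasure (g.toContMDiffRiemannianMetric hg)) = 1 →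
      c ≤ ∫ x, (τ * (g.scalarCurvature x + g.gradSq f x) + f x - 4) *
        ((4 * Real.pi * τ) ^ (-(4 : ℝ) / 2) * Real.exp (-f x))
          ∂(riemannianMeasure (g.toContMDiffRiemannianMetric hg))

omit [IsManifold (𝓡 4) ∞ M] in
/-- The uniform gap implies the non-strict bound (`c + δ ≤ 𝒲` ⇒ `c ≤ 𝒲`). [folklore] -/
theorem EntropyAbove.atLeast [IsManifold (𝓡 4) ∞ M] {g : Metric4 M} [g.HasLeviCivita]
    {hg : g.IsRiemannian} {c : ℝ} (h : EntropyAbove g hg c) : EntropyAtLeast g hg c := by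
  obtain ⟨δ, hδ, H⟩ := h
  intro τ hτ f hf h1
  have := H τ hτ f hf h1
  linarith

/-- Lowering the threshold weakens the hypothesis: `EntropyAbove g hg c' → EntropyAbove g hg c` for `c ≤ c'`.
[folklore] -/
theorem EntropyAbove.mono {g : Metric4 M} [g.HasLeviCivita] {hg : g.IsRiemannian} {c c' : ℝ}
    (hcc' : c ≤ c') (h : EntropyAbove g hg c') : EntropyAbove g hg c := by
  obtain ⟨δ, hδ, H⟩ := h
  exact ⟨δ, hδ, fun τ hτ f hf h1 => le_trans (by linarith) (H τ hτ f hf h1)⟩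

end Hyp

/-! ## §1 Shape: generic threshold, SPC4 ⇒ crux, exotic-free form -/

/-- `Recognition c`: the crux with the threshold `ν_cyl` replaced by an arbitrary real `c`
(`Recognition nuCyl` IS the crux, `recognition_nuCyl_iff`). -/
def Recognition (c : ℝ) : Prop :=
  ∀ (M : Type) [TopologicalSpace M] [T2Space M] [SecondCountableTopology M]
    [ChartedSpace (EuclideanSpace ℝ (Fin 4)) M] [IsManifold (𝓡 4) ∞ M] [CompactSpace M] [T3Space M]
    [MeasurableSpace M] [BorelSpace M],
    M ≃ₕ 𝕊⁴ → ∀ (g : Metric4 M) [g.HasLeviCivita] (hg : g.IsRiemannian),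
      (∀ x : M, 0 < g.scalarCurvature x) → EntropyAbove g hg c → Nonempty (M ≃ₘ⟮𝓡 4, 𝓡 4⟯ 𝕊⁴)

/-- `Recognition ν_cyl` is the crux, definitionally. [folklore] -/
theorem recognition_nuCyl_iff : Recognition nuCyl ↔ SubcylindricalRecognition := by
  unfold Recognition EntropyAbove nuCyl SubcylindricalRecognition
  exact Iff.rfl

/-- Raising the threshold weakens the statement: `c ≤ c' → Recognition c → Recognition c'`. So every
`Recognition c`, `c ≤ ν_cyl`, is at least as strong as the crux and every `c ≥ ν_cyl` at most as strong; all of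
them are SPC4-implied (`spc4_imp_recognition`). [folklore] -/
theorem recognition_mono {c c' : ℝ} (hcc' : c ≤ c') (h : Recognition c) : Recognition c' := by
  intro M _ _ _ _ _ _ _ _ _ e g _ hg hR hν
  exact h M e g hg hR (hν.mono hcc')

/-- **SPC4 ⇒ `Recognition c` for every threshold `c`** (one line: the conclusion only depends on `M`).
Consequently no counterexample to any threshold variant exists unless an exotic 4-sphere exists. [folklore] -/
theorem spc4_imp_recognition (h : _root_.SmoothPoincare4) (c : ℝ) : Recognition c := by
  intro M _ _ _ _ _ _ _ _ _ e g _ hg _ _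
  exact h M ‹_› ‹_› e

/-- **SPC4 ⇒ the crux.** A refutation of `SubcylindricalRecognition` would refute the summit. [folklore] -/
theorem spc4_imp (h : _root_.SmoothPoincare4) : SubcylindricalRecognition :=
  recognition_nuCyl_iff.1 (spc4_imp_recognition h nuCyl)

/-- `NoSupercylindricalExotic c`: there is no closed smooth `M ≃ₕ S⁴` carrying a Riemannian metric with
`R > 0` and `ν > c` (typed as `EntropyAbove`) that fails to be diffeomorphic to `S⁴`. -/
def NoSupercylindricalExotic (c : ℝ) : Prop :=
  ¬ ∃ (M : Type) (_ : TopologicalSpace M) (_ : T2Space M) (_ : SecondCountableTopology M)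
      (_ : ChartedSpace (EuclideanSpace ℝ (Fin 4)) M) (_ : IsManifold (𝓡 4) ∞ M) (_ : CompactSpace M)
      (_ : T3Space M) (_ : MeasurableSpace M) (_ : BorelSpace M) (_ : M ≃ₕ 𝕊⁴) (g : Metric4 M)
      (_ : g.HasLeviCivita) (hg : g.IsRiemannian),
      (∀ x : M, 0 < g.scalarCurvature x) ∧ EntropyAbove g hg c ∧ IsEmpty (M ≃ₘ⟮𝓡 4, 𝓡 4⟯ 𝕊⁴)

/-- **Exotic-free form.** `Recognition c` ⟺ no super-`c` PSC metric lives on a fake 4-sphere. For `c = ν_cyl`: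
the crux is EQUIVALENT to "no exotic S⁴ carries a metric with R > 0 and ν > ν_cyl"; a disproof must exhibit an
exotic S⁴ (and such a metric on it). [folklore] -/
theorem recognition_iff_noExotic (c : ℝ) : Recognition c ↔ NoSupercylindricalExotic c := by
  constructor
  · intro h hex
    obtain ⟨M, i1, i2, i3, i4, i5, i6, i7, i8, i9, e, g, iLC, hg, hR, hν, hE⟩ := hex
    exact hE.false (h M e g hg hR hν).some
  · intro h M i1 i2 i3 i4 i5 i6 i7 i8 i9 e g iLC hg hR hν
    by_contra hne
    exact h ⟨M, i1, i2, i3, i4, i5, i6, i7, i8, i9, e, g, iLC, hg, hR, hν, not_nonempty_iff.1 hne⟩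

/-! ## §2 Load-bearing analysis: drop / weaken one hypothesis at a time -/

/-- RUNG without the homotopy hypothesis `M ≃ₕ S⁴` (everything else verbatim). -/
def RecognitionWithoutHomotopyEquiv (c : ℝ) : Prop :=
  ∀ (M : Type) [TopologicalSpace M] [T2Space M] [SecondCountableTopology M]
    [ChartedSpace (EuclideanSpace ℝ (Fin 4)) M] [IsManifold (𝓡 4) ∞ M] [CompactSpace M] [T3Space M]
    [MeasurableSpace M] [BorelSpace M],
    ∀ (g : Metric4 M) [g.HasLeviCivita] (hg : g.IsRiemannian),
      (∀ x : M, 0 < g.scalarCurvature x) → EntropyAbove g hg c → Nonempty (M ≃ₘ⟮𝓡 4, 𝓡 4⟯ 𝕊⁴)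

/-- The empty type as a (`C^∞`, closed) 4-manifold: empty atlas. -/
instance instChartedSpaceEmpty : ChartedSpace (EuclideanSpace ℝ (Fin 4)) Empty where
  atlas := ∅
  chartAt x := x.elim
  mem_chart_source x := x.elim
  chart_mem_atlas x := x.elim

/-- The empty atlas is `C^∞`-compatible. -/
instance instIsManifoldEmpty : IsManifold (𝓡 4) ∞ Empty where
  compatible he _ := (Set.notMem_empty _ he).elim

/-- The (unique) metric on the empty 4-manifold. -/
def emptyMetric : Metric4 Empty where
  val b := b.elim
  symm b := b.elim
  nondegenerate b := b.elim
  contMDiff b := b.elim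

/-- **Dropping `M ≃ₕ S⁴` makes the statement FALSE as typed — junk witness `M = ∅`.** On the empty 4-manifold
every hypothesis holds vacuously (`R > 0` at no point; the normalisation `∫ (4πτ)⁻² e^{−f} dV = 1` is never
met because the measure is `0`, so the entropy clause holds with any δ), while `Nonempty (∅ ≃ₘ S⁴)` fails. This is
the ONLY kill found: see `ConnectedRecognition` for the honest variant (no counterexample known).
Classification if it were filed: refuted-misstated (repair: add `M ≃ₕ S⁴`, i.e. the crux itself, or
`[Nonempty M] [ConnectedSpace M]`). [folklore] -/
theorem recognitionWithoutHomotopyEquiv_false (c : ℝ) : ¬ RecognitionWithoutHomotopyEquiv c := by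
  intro h
  letI : MeasurableSpace Empty := borel Empty
  haveI : BorelSpace Empty := ⟨rfl⟩
  haveI := (emptyMetric).hasLeviCivita
  have hg : emptyMetric.IsRiemannian := fun b => b.elim
  have hν : EntropyAbove emptyMetric hg c := ⟨1, one_pos, fun τ _ f _ h1 => by
    rw [Measure.eq_zero_of_isEmpty (riemannianMeasure _), integral_zero_measure] at h1
    exact (zero_ne_one h1).elim⟩
  obtain ⟨φ⟩ := h Empty emptyMetric hg (fun b => b.elim) hν
  have p : 𝕊⁴ := ⟨EuclideanSpace.single 0 1, by simp⟩
  exact (φ.symm p).elim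

/-- The honest `≃ₕ`-free variant: closed CONNECTED non-empty `M⁴` with `R > 0` and `ν > c` is diffeomorphic to
`S⁴`. STATUS (informal, c = ν_cyl): NO counterexample known and plausibly TRUE — every closed non-spherical
model in the 4-d density table is far below the cylinder: ℝP⁴ .406 (= Θ(S⁴)/2), ℂP² .609, S²×S² .541,
Koiso–Cao .518, Page .517, and products/quotients S³×S¹, S²×T², T⁴ have ν = −∞ or ν ≤ ν(S³) + 0 = ν_cyl
(split lemma); a flow from ν > ν_cyl on any closed M⁴ can (given the two gaps + the compact gap for ALL
topologies) only go extinct roundly. Not SPC4-implied (conclusion no longer guarded by `≃ₕ`), not attacked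
further: dropping `≃ₕ` is on no planner's agenda, and ν of an explicit metric is not computable in the tree. -/
def ConnectedRecognition (c : ℝ) : Prop :=
  ∀ (M : Type) [TopologicalSpace M] [T2Space M] [SecondCountableTopology M]
    [ChartedSpace (EuclideanSpace ℝ (Fin 4)) M] [IsManifold (𝓡 4) ∞ M] [CompactSpace M] [T3Space M]
    [MeasurableSpace M] [BorelSpace M] [Nonempty M] [ConnectedSpace M],
    ∀ (g : Metric4 M) [g.HasLeviCivita] (hg : g.IsRiemannian),
      (∀ x : M, 0 < g.scalarCurvature x) → EntropyAbove g hg c → Nonempty (M ≃ₘ⟮𝓡 4, 𝓡 4⟯ 𝕊⁴)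

/-- RUNG without `R > 0`. -/
def RecognitionWithoutPSC (c : ℝ) : Prop :=
  ∀ (M : Type) [TopologicalSpace M] [T2Space M] [SecondCountableTopology M]
    [ChartedSpace (EuclideanSpace ℝ (Fin 4)) M] [IsManifold (𝓡 4) ∞ M] [CompactSpace M] [T3Space M]
    [MeasurableSpace M] [BorelSpace M],
    M ≃ₕ 𝕊⁴ → ∀ (g : Metric4 M) [g.HasLeviCivita] (hg : g.IsRiemannian),
      EntropyAbove g hg c → Nonempty (M ≃ₘ⟮𝓡 4, 𝓡 4⟯ 𝕊⁴)

/-- RUNG without the entropy hypothesis (= "a PSC metric on a homotopy 4-sphere recognises S⁴"). -/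
def RecognitionWithoutEntropy : Prop :=
  ∀ (M : Type) [TopologicalSpace M] [T2Space M] [SecondCountableTopology M]
    [ChartedSpace (EuclideanSpace ℝ (Fin 4)) M] [IsManifold (𝓡 4) ∞ M] [CompactSpace M] [T3Space M]
    [MeasurableSpace M] [BorelSpace M],
    M ≃ₕ 𝕊⁴ → ∀ (g : Metric4 M) [g.HasLeviCivita] (_hg : g.IsRiemannian),
      (∀ x : M, 0 < g.scalarCurvature x) → Nonempty (M ≃ₘ⟮𝓡 4, 𝓡 4⟯ 𝕊⁴)

/-- RUNG without any metric (= SPC4 over the crux's binder). -/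
def RecognitionWithoutMetric : Prop :=
  ∀ (M : Type) [TopologicalSpace M] [T2Space M] [SecondCountableTopology M]
    [ChartedSpace (EuclideanSpace ℝ (Fin 4)) M] [IsManifold (𝓡 4) ∞ M] [CompactSpace M] [T3Space M]
    [MeasurableSpace M] [BorelSpace M],
    M ≃ₕ 𝕊⁴ → Nonempty (M ≃ₘ⟮𝓡 4, 𝓡 4⟯ 𝕊⁴)

/-- RUNG with the non-strict, non-uniform entropy hypothesis `μ(g,τ) ≥ c ∀ τ` (strongest natural variant on the
entropy side). -/
def RecognitionAtLeast (c : ℝ) : Prop :=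
  ∀ (M : Type) [TopologicalSpace M] [T2Space M] [SecondCountableTopology M]
    [ChartedSpace (EuclideanSpace ℝ (Fin 4)) M] [IsManifold (𝓡 4) ∞ M] [CompactSpace M] [T3Space M]
    [MeasurableSpace M] [BorelSpace M],
    M ≃ₕ 𝕊⁴ → ∀ (g : Metric4 M) [g.HasLeviCivita] (hg : g.IsRiemannian),
      (∀ x : M, 0 < g.scalarCurvature x) → EntropyAtLeast g hg c → Nonempty (M ≃ₘ⟮𝓡 4, 𝓡 4⟯ 𝕊⁴)

/-- Strength ordering: no metric ⇒ no entropy ⇒ crux-shape. [folklore] -/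
theorem withoutMetric_imp_withoutEntropy (h : RecognitionWithoutMetric) : RecognitionWithoutEntropy :=
  fun M _ _ _ _ _ _ _ _ _ e _ _ _ _ => h M e

/-- [folklore] -/
theorem withoutEntropy_imp_recognition (h : RecognitionWithoutEntropy) (c : ℝ) : Recognition c :=
  fun M _ _ _ _ _ _ _ _ _ e g _ hg hR _ => h M e g hg hR

/-- [folklore] -/
theorem withoutPSC_imp_recognition {c : ℝ} (h : RecognitionWithoutPSC c) : Recognition c :=
  fun M _ _ _ _ _ _ _ _ _ e g _ hg _ hν => h M e g hg hν

/-- [folklore] -/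
theorem recognitionAtLeast_imp_recognition {c : ℝ} (h : RecognitionAtLeast c) : Recognition c :=
  fun M _ _ _ _ _ _ _ _ _ e g _ hg hR hν => h M e g hg hR hν.atLeast

/-- **Dropping every metric hypothesis gives exactly SPC4** (the extra binders `CompactSpace`, `T3Space`,
`MeasurableSpace`, `BorelSpace` of the crux are dischargeable from `M ≃ₕ S⁴`: Hatcher 3.29 in the tree, compact
T₂ ⇒ T₃, Borel σ-algebra). So the metric hypotheses are the WHOLE content of the crux relative to the summit.
[folklore] -/
theorem withoutMetric_iff_spc4 : RecognitionWithoutMetric ↔ _root_.SmoothPoincare4 := by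
  constructor
  · intro h M _ _ _ _ _ e
    haveI : CompactSpace M :=
      Literature.Topology.FourManifolds.compactSpace_of_homotopyEquiv_sphere_four_holds M e
    letI : MeasurableSpace M := borel M
    haveI : BorelSpace M := ⟨rfl⟩
    exact h M e
  · intro h M _ _ _ _ _ _ _ _ _ e
    exact h M ‹_› ‹_› e

/-- SPC4 ⇒ RUNG-without-`R>0`: the PSC hypothesis cannot be shown necessary by a counterexample. [folklore] -/
theorem spc4_imp_withoutPSC (h : _root_.SmoothPoincare4) (c : ℝ) : RecognitionWithoutPSC c :=
  fun M _ _ _ _ _ _ _ _ _ e _ _ _ _ => h M ‹_› ‹_› e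

/-- SPC4 ⇒ RUNG-without-entropy. [folklore] -/
theorem spc4_imp_withoutEntropy (h : _root_.SmoothPoincare4) : RecognitionWithoutEntropy :=
  withoutMetric_imp_withoutEntropy (withoutMetric_iff_spc4.2 h)

/-- SPC4 ⇒ the non-strict variant. [folklore] -/
theorem spc4_imp_recognitionAtLeast (h : _root_.SmoothPoincare4) (c : ℝ) : RecognitionAtLeast c :=
  fun M _ _ _ _ _ _ _ _ _ e _ _ _ _ _ => h M ‹_› ‹_› e

/-- RUNG without the `[CompactSpace M]` binder. -/
def RecognitionWithoutCompact (c : ℝ) : Prop :=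
  ∀ (M : Type) [TopologicalSpace M] [T2Space M] [SecondCountableTopology M]
    [ChartedSpace (EuclideanSpace ℝ (Fin 4)) M] [IsManifold (𝓡 4) ∞ M] [T3Space M]
    [MeasurableSpace M] [BorelSpace M],
    M ≃ₕ 𝕊⁴ → ∀ (g : Metric4 M) [g.HasLeviCivita] (hg : g.IsRiemannian),
      (∀ x : M, 0 < g.scalarCurvature x) → EntropyAbove g hg c → Nonempty (M ≃ₘ⟮𝓡 4, 𝓡 4⟯ 𝕊⁴)

/-- The compactness binder is decoration (it follows from `M ≃ₕ S⁴`, Hatcher 3.29 in the tree). [folklore] -/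
theorem withoutCompact_iff (c : ℝ) : RecognitionWithoutCompact c ↔ Recognition c := by
  constructor
  · intro h M _ _ _ _ _ _ _ _ _ e g _ hg hR hν
    exact h M e g hg hR hν
  · intro h M _ _ _ _ _ _ _ _ e g _ hg hR hν
    haveI : CompactSpace M :=
      Literature.Topology.FourManifolds.compactSpace_of_homotopyEquiv_sphere_four_holds M e
    exact h M e g hg hR hν

/-! ## §3 Certified window arithmetic (the 4-d density table entries that the route quotes) -/

/-- `Θ(S⁴) = 6/e²` (Einstein shrinker `S⁴(√6)`, `∫ e^{−f} dV = 96π² e⁻²`). -/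
def thetaSph : ℝ := 6 / Real.exp 2
/-- `Θ(S³×ℝ) = Θ(S³) = 2√π e^{−3/2}` (cylinder `S³(2)×ℝ`, `∫ e^{−f} dV = 32π²√π e^{−3/2}`). -/
def thetaCyl : ℝ := 2 * Real.sqrt Real.pi * Real.exp (-(3 : ℝ) / 2)
/-- `Θ(S²×ℝ²) = Θ(S²) = 2/e` (also `Θ(ℂ×ℙ¹)`, the top non-flat Kähler value in real dimension 4). -/
def thetaS2R2 : ℝ := 2 / Real.exp 1
/-- `Θ(ℂP²) = 9/(2e²)`. -/
def thetaCP2 : ℝ := 9 / (2 * Real.exp 2)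
/-- `Θ(S²×S²) = 4/e²`. -/
def thetaS2S2 : ℝ := 4 / Real.exp 2
/-- Gursky's bound `Θ ≤ Θ(S⁴)/3 = 2/e²` for a NON-round Einstein metric on a homotopy 4-sphere
(χ = 2, σ = 0: `W^± ≢ 0 ⇒ ∫|W^±|² ≥ 16π²/3` each ⇒ `Vol ≤ Vol(S⁴)/3`). -/
def thetaEinsteinNonround : ℝ := 2 / Real.exp 2

private lemma exp_two_eq : Real.exp 2 = Real.exp 1 * Real.exp 1 := by
  rw [← Real.exp_add]; norm_num

private lemma exp_half_sq : Real.exp (1 / 2) * Real.exp (1 / 2) = Real.exp 1 := by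
  rw [← Real.exp_add]; norm_num

private lemma exp_neg_three_halves :
    Real.exp (-(3 : ℝ) / 2) = (Real.exp 1 * Real.exp (1 / 2))⁻¹ := by
  rw [← Real.exp_add, ← Real.exp_neg]; norm_num

private lemma sqrt_pi_sq : Real.sqrt Real.pi * Real.sqrt Real.pi = Real.pi :=
  Real.mul_self_sqrt Real.pi_pos.le

private lemma e_lt_272 : Real.exp 1 < 2.72 := lt_trans Real.exp_one_lt_d9 (by norm_num)
private lemma e_gt_271 : (2.71 : ℝ) < Real.exp 1 := lt_trans (by norm_num) Real.exp_one_gt_d9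

/-- `√e < √π` (⟺ `e < π`). -/
private lemma exp_half_lt_sqrt_pi : Real.exp (1 / 2) < Real.sqrt Real.pi := by
  have hE : Real.exp 1 < Real.pi := lt_trans e_lt_272 (by linarith [Real.pi_gt_d2])
  have h0 : (0 : ℝ) ≤ Real.exp (1 / 2) := (Real.exp_pos _).le
  have h1 : (0 : ℝ) ≤ Real.sqrt Real.pi := Real.sqrt_nonneg _
  exact (mul_self_lt_mul_self_iff h0 h1).2 (by rw [exp_half_sq, sqrt_pi_sq]; exact hE)

/-- `Θ(S²×ℝ²) < Θ(S³×ℝ)` ⟺ `e < π`: the top non-flat KÄHLER density of real dimension 4 (`2/e`, attained by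
`ℂ×ℙ¹`; Li–Wang arXiv:2301.09784 Thm 1.1 + the cycle-1 toric computation) is below the cylinder, so the whole
Kähler world satisfies NoncompactShrinkerGap/CompactShrinkerGap with margin `.0552`. [folklore] -/
theorem thetaS2R2_lt_thetaCyl : thetaS2R2 < thetaCyl := by
  unfold thetaS2R2 thetaCyl
  rw [exp_neg_three_halves]
  have hE0 := Real.exp_pos 1
  have hs0 := Real.exp_pos (1 / 2)
  rw [show (2 : ℝ) / Real.exp 1 = 2 * Real.exp (1 / 2) * (Real.exp 1 * Real.exp (1 / 2))⁻¹ by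
    field_simp]
  have hinv : 0 < (Real.exp 1 * Real.exp (1 / 2))⁻¹ := inv_pos.2 (mul_pos hE0 hs0)
  exact mul_lt_mul_of_pos_right (by linarith [exp_half_lt_sqrt_pi]) hinv

/-- `Θ(S³×ℝ) < Θ(S⁴)` ⟺ `πe < 9`: the sphere tops the cylinder (ratio 1.0266); this is the whole window of the
route. [folklore] -/
theorem thetaCyl_lt_thetaSph : thetaCyl < thetaSph := by
  unfold thetaCyl thetaSph
  rw [exp_neg_three_halves, exp_two_eq]
  have hE0 := Real.exp_pos 1
  have hs0 := Real.exp_pos (1 / 2)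
  have hp0 : 0 < Real.sqrt Real.pi := Real.sqrt_pos.2 Real.pi_pos
  -- key: √π · e < 3 · √e  ⟺  π e² < 9 e ⟺ π e < 9
  have hkey : Real.sqrt Real.pi * Real.exp 1 < 3 * Real.exp (1 / 2) := by
    have h0 : (0 : ℝ) ≤ Real.sqrt Real.pi * Real.exp 1 := by positivity
    have h1 : (0 : ℝ) ≤ 3 * Real.exp (1 / 2) := by positivity
    refine (mul_self_lt_mul_self_iff h0 h1).2 ?_
    have eq1 : Real.sqrt Real.pi * Real.exp 1 * (Real.sqrt Real.pi * Real.exp 1)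
        = Real.pi * (Real.exp 1 * Real.exp 1) := by
      linear_combination (Real.exp 1 * Real.exp 1) * sqrt_pi_sq
    have eq2 : (3 : ℝ) * Real.exp (1 / 2) * (3 * Real.exp (1 / 2)) = 9 * Real.exp 1 := by
      linear_combination (9 : ℝ) * exp_half_sq
    rw [eq1, eq2]
    have hpi := Real.pi_lt_d2
    nlinarith [e_lt_272, hE0, Real.pi_pos]
  rw [show 2 * Real.sqrt Real.pi * (Real.exp 1 * Real.exp (1 / 2))⁻¹
      = (2 * Real.sqrt Real.pi) / (Real.exp 1 * Real.exp (1 / 2)) from (div_eq_mul_inv _ _).symm]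
  rw [div_lt_div_iff₀ (by positivity) (by positivity)]
  nlinarith [hkey, hE0, hs0]

/-- `Θ(S⁴) < 1 = Θ(ℝ⁴)` ⟺ `6 < e²`. [folklore] -/
theorem thetaSph_lt_one : thetaSph < 1 := by
  unfold thetaSph
  rw [div_lt_one (Real.exp_pos 2), exp_two_eq]
  nlinarith [e_gt_271]

/-- `Θ(ℂP²) < Θ(S²×ℝ²)` ⟺ `9 < 4e`. [folklore] -/
theorem thetaCP2_lt_thetaS2R2 : thetaCP2 < thetaS2R2 := by
  unfold thetaCP2 thetaS2R2
  rw [exp_two_eq, div_lt_div_iff₀ (by positivity) (Real.exp_pos 1)]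
  nlinarith [e_gt_271, Real.exp_pos 1]

/-- `Θ(S²×S²) < Θ(ℂP²)` ⟺ `8 < 9`. [folklore] -/
theorem thetaS2S2_lt_thetaCP2 : thetaS2S2 < thetaCP2 := by
  unfold thetaS2S2 thetaCP2
  rw [div_lt_div_iff₀ (Real.exp_pos 2) (by positivity)]
  nlinarith [Real.exp_pos 2]

/-- **Orbifold margin.** `1/2 < Θ(S³×ℝ)` ⟺ `e³ < 16π`: an orbifold shrinker with a singular point `ℝ⁴/Γ`,
`Γ ≠ 1`, has `Θ ≤ 1/|Γ| ≤ 1/2` (Nash-entropy monotonicity on its own flow), hence is excluded by the crux's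
threshold with margin `.291`; the "why it might fail" clause "(orbifold)" of the item is void. [folklore] -/
theorem half_lt_thetaCyl : (1 : ℝ) / 2 < thetaCyl := by
  unfold thetaCyl
  rw [exp_neg_three_halves]
  have hE0 := Real.exp_pos 1
  have hs0 := Real.exp_pos (1 / 2)
  have hp0 : 0 < Real.sqrt Real.pi := Real.sqrt_pos.2 Real.pi_pos
  -- key: e·√e < 4√π ⟺ e³ < 16π
  have hkey : Real.exp 1 * Real.exp (1 / 2) < 4 * Real.sqrt Real.pi := by
    have h0 : (0 : ℝ) ≤ Real.exp 1 * Real.exp (1 / 2) := by positivity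
    have h1 : (0 : ℝ) ≤ 4 * Real.sqrt Real.pi := by positivity
    refine (mul_self_lt_mul_self_iff h0 h1).2 ?_
    have eq1 : Real.exp 1 * Real.exp (1 / 2) * (Real.exp 1 * Real.exp (1 / 2))
        = Real.exp 1 * Real.exp 1 * Real.exp 1 := by
      linear_combination (Real.exp 1 * Real.exp 1) * exp_half_sq
    have eq2 : (4 : ℝ) * Real.sqrt Real.pi * (4 * Real.sqrt Real.pi) = 16 * Real.pi := by
      linear_combination (16 : ℝ) * sqrt_pi_sq
    rw [eq1, eq2]
    have hpi := Real.pi_gt_d2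
    nlinarith [e_lt_272, hE0, mul_pos hE0 hE0]
  rw [show 2 * Real.sqrt Real.pi * (Real.exp 1 * Real.exp (1 / 2))⁻¹
      = (2 * Real.sqrt Real.pi) / (Real.exp 1 * Real.exp (1 / 2)) from (div_eq_mul_inv _ _).symm]
  rw [div_lt_div_iff₀ (by norm_num) (by positivity)]
  nlinarith [hkey]

/-- **Einstein margin of the compact gap.** `2/e² < Θ(S³×ℝ)` ⟺ `1 < πe`: a non-round Einstein metric on a
homotopy 4-sphere has `Θ ≤ 2/e² = .2707` (Hitchin + Gursky, route text), below the cylinder by `.52`; so the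
Einstein sub-case of CompactShrinkerGap (10870) — the only case any line reaches — is closed modulo vending
Gursky2000, and the live risk is NON-Einstein compact shrinkers on homotopy spheres only. [folklore] -/
theorem thetaEinsteinNonround_lt_thetaCyl : thetaEinsteinNonround < thetaCyl := by
  unfold thetaEinsteinNonround thetaCyl
  rw [exp_neg_three_halves, exp_two_eq]
  have hE0 := Real.exp_pos 1
  have hs0 := Real.exp_pos (1 / 2)
  have hp0 : 0 < Real.sqrt Real.pi := Real.sqrt_pos.2 Real.pi_pos
  -- key: √e < √π · e ⟺ 1 < π e
  have hkey : Real.exp (1 / 2) < Real.sqrt Real.pi * Real.exp 1 := by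
    have h0 : (0 : ℝ) ≤ Real.exp (1 / 2) := hs0.le
    have h1 : (0 : ℝ) ≤ Real.sqrt Real.pi * Real.exp 1 := by positivity
    refine (mul_self_lt_mul_self_iff h0 h1).2 ?_
    have eq1 : Real.sqrt Real.pi * Real.exp 1 * (Real.sqrt Real.pi * Real.exp 1)
        = Real.pi * (Real.exp 1 * Real.exp 1) := by
      linear_combination (Real.exp 1 * Real.exp 1) * sqrt_pi_sq
    rw [exp_half_sq, eq1]
    have hpi := Real.pi_gt_d2
    nlinarith [e_gt_271, hE0]
  rw [show 2 * Real.sqrt Real.pi * (Real.exp 1 * Real.exp (1 / 2))⁻¹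
      = (2 * Real.sqrt Real.pi) / (Real.exp 1 * Real.exp (1 / 2)) from (div_eq_mul_inv _ _).symm]
  rw [div_lt_div_iff₀ (by positivity) (by positivity)]
  nlinarith [hkey, hE0, hs0]

/-- `Θ(FIK) = (1+√2) e^{√2−2} / 2` : the toric/U(2) Kähler shrinker on `Bl₀ ℂ² = O(−1)`:
`Θ = e^{−2} min_{a>0} e^{a}(1/a + 1/a²)`, minimum at `a = √2`. -/
def thetaFIK : ℝ := (1 + Real.sqrt 2) * Real.exp (Real.sqrt 2 - 2) / 2

/-- `1.414 < √2 < 1.4143`. [folklore] -/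
private lemma sqrt2_bounds : (1.414 : ℝ) < Real.sqrt 2 ∧ Real.sqrt 2 < 1.4143 := by
  constructor
  · rw [Real.lt_sqrt (by norm_num)]; norm_num
  · rw [Real.sqrt_lt' (by norm_num)]; norm_num

/-- `√2·√2 = 2`. [folklore] -/
private lemma sqrt2_sq : Real.sqrt 2 * Real.sqrt 2 = 2 := Real.mul_self_sqrt (by norm_num)

/-- `Θ(ℂP²) < Θ(FIK)` ⟺ `9 < (1+√2) e^{√2}` (via `e^{√2} = e · e^{√2−1} ≥ e√2`). [folklore] -/
theorem thetaCP2_lt_thetaFIK : thetaCP2 < thetaFIK := by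
  unfold thetaCP2 thetaFIK
  obtain ⟨hs1, hs2⟩ := sqrt2_bounds
  have hE0 := Real.exp_pos 1
  have hE := Real.exp_one_gt_d9
  -- e^{√2 - 2} = e^{√2 - 1} / e ... write exp(√2 - 2) * exp 2 = exp(√2)
  have hkey : 9 < (1 + Real.sqrt 2) * Real.exp (Real.sqrt 2) := by
    have h1 : Real.sqrt 2 * Real.exp 1 ≤ Real.exp (Real.sqrt 2) := by
      have := Real.add_one_le_exp (Real.sqrt 2 - 1)
      have h2 : Real.exp (Real.sqrt 2) = Real.exp (Real.sqrt 2 - 1) * Real.exp 1 := by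
        rw [← Real.exp_add]; ring_nf
      rw [h2]
      have : Real.sqrt 2 ≤ Real.exp (Real.sqrt 2 - 1) := by linarith
      exact mul_le_mul_of_nonneg_right this hE0.le
    have h2 := mul_le_mul_of_nonneg_left h1 (by positivity : (0:ℝ) ≤ 1 + Real.sqrt 2)
    have h3' : (1 + Real.sqrt 2) * (Real.sqrt 2 * Real.exp 1) = (Real.sqrt 2 + 2) * Real.exp 1 := by
      linear_combination (Real.exp 1) * sqrt2_sq
    have h4 : (3.414 : ℝ) * 2.7182818283 ≤ (Real.sqrt 2 + 2) * Real.exp 1 :=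
      mul_le_mul (by linarith) hE.le (by norm_num) (by linarith)
    nlinarith [h2, h3', h4]
  have h3 : Real.exp (Real.sqrt 2 - 2) * Real.exp 2 = Real.exp (Real.sqrt 2) := by
    rw [← Real.exp_add]; ring_nf
  rw [div_lt_div_iff₀ (by positivity) (by norm_num)]
  nlinarith [h3, hkey, Real.exp_pos 2, Real.exp_pos (Real.sqrt 2 - 2)]

/-- **FIK sits below the bubble sheet**: `Θ(FIK) < Θ(S²×ℝ²)` ⟺ `(1+√2) e^{√2−1} < 4` (via `e^{y} ≤ 1/(1−y)`,
`y = (√2−1)/2`, twice). With `thetaCP2_lt_thetaFIK` the certified chain reads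
`S²×S² < ℂP² < FIK < S²×ℝ² < S³×ℝ < S⁴ < 1`. [folklore] -/
theorem thetaFIK_lt_thetaS2R2 : thetaFIK < thetaS2R2 := by
  unfold thetaFIK thetaS2R2
  obtain ⟨hs1, hs2⟩ := sqrt2_bounds
  have hE0 := Real.exp_pos 1
  set y : ℝ := (Real.sqrt 2 - 1) / 2 with hy
  have hy0 : 0 < y := by rw [hy]; linarith
  have hy1 : y < 0.20715 := by rw [hy]; linarith
  -- e^{y} (1 - y) ≤ 1
  have hexp_y : Real.exp y * (1 - y) ≤ 1 := by
    have h := Real.add_one_le_exp (-y)   -- -y + 1 ≤ exp (-y)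
    have h' : Real.exp y * Real.exp (-y) = 1 := by rw [← Real.exp_add]; simp
    nlinarith [Real.exp_pos y, h, h']
  have hexp_yy : Real.exp (Real.sqrt 2 - 1) = Real.exp y * Real.exp y := by
    rw [← Real.exp_add, hy]; ring_nf
  -- bound: exp(√2 - 1) * (1-y)^2 ≤ 1
  have hb : Real.exp (Real.sqrt 2 - 1) * (1 - y) ^ 2 ≤ 1 := by
    rw [hexp_yy]
    have h1y : 0 ≤ 1 - y := by linarith
    nlinarith [hexp_y, Real.exp_pos y, mul_nonneg (Real.exp_pos y).le h1y]
  -- target: (1+√2) exp(√2-2)/2 < 2/exp 1  ⟺ (1+√2) exp(√2-1) < 4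
  have h3 : Real.exp (Real.sqrt 2 - 2) * Real.exp 1 = Real.exp (Real.sqrt 2 - 1) := by
    rw [← Real.exp_add]; ring_nf
  rw [div_lt_div_iff₀ (by norm_num) hE0]
  -- (1+√2) exp(√2-2) * exp 1 < 2 * 2
  have hfin : (1 + Real.sqrt 2) * Real.exp (Real.sqrt 2 - 1) < 4 := by
    -- (1-y)^2 ≥ (1 - 0.20715)^2 > 0.6286 and (1+√2) < 2.4143 ⇒ (1+√2)/(1-y)^2 < 3.841
    have h1y2 : (0.6286 : ℝ) < (1 - y) ^ 2 := by nlinarith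
    have hpos : 0 < Real.exp (Real.sqrt 2 - 1) := Real.exp_pos _
    nlinarith [hb, h1y2, hpos, hs2]
  nlinarith [hfin, h3, Real.exp_pos (Real.sqrt 2 - 2)]

/-- **Quotients are harmless**: `Θ(ℝP⁴) = Θ(S⁴)/2 < Θ(S³×ℝ)` ⟺ `9 < 4πe` (`Θ(N/Γ) = Θ(N)/|Γ|`; the only
closed quotient of the sphere, and every `S³/Γ × ℝ`, `Γ ≠ 1`, lies below the cylinder). [folklore] -/
theorem thetaSph_half_lt_thetaCyl : thetaSph / 2 < thetaCyl := by
  unfold thetaSph thetaCyl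
  have hE0 := Real.exp_pos 1
  have hs0 := Real.exp_pos (1 / 2)
  have hp0 : 0 < Real.sqrt Real.pi := Real.sqrt_pos.2 Real.pi_pos
  have exp_two_eq : Real.exp 2 = Real.exp 1 * Real.exp 1 := by rw [← Real.exp_add]; norm_num
  have exp_half_sq : Real.exp (1 / 2) * Real.exp (1 / 2) = Real.exp 1 := by rw [← Real.exp_add]; norm_num
  have e32 : Real.exp (-(3 : ℝ) / 2) = (Real.exp 1 * Real.exp (1 / 2))⁻¹ := by
    rw [← Real.exp_add, ← Real.exp_neg]; norm_num
  have sqrt_pi_sq : Real.sqrt Real.pi * Real.sqrt Real.pi = Real.pi := Real.mul_self_sqrt Real.pi_pos.le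
  rw [e32, exp_two_eq]
  -- key: 3 √e < 2 √π e ⟺ 9 e < 4 π e² ⟺ 9 < 4 π e
  have hkey : 3 * Real.exp (1 / 2) < 2 * Real.sqrt Real.pi * Real.exp 1 := by
    have h0 : (0 : ℝ) ≤ 3 * Real.exp (1 / 2) := by positivity
    have h1 : (0 : ℝ) ≤ 2 * Real.sqrt Real.pi * Real.exp 1 := by positivity
    refine (mul_self_lt_mul_self_iff h0 h1).2 ?_
    have eq1 : (3 : ℝ) * Real.exp (1 / 2) * (3 * Real.exp (1 / 2)) = 9 * Real.exp 1 := by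
      linear_combination (9 : ℝ) * exp_half_sq
    have eq2 : 2 * Real.sqrt Real.pi * Real.exp 1 * (2 * Real.sqrt Real.pi * Real.exp 1)
        = 4 * Real.pi * (Real.exp 1 * Real.exp 1) := by
      linear_combination (4 * Real.exp 1 * Real.exp 1) * sqrt_pi_sq
    rw [eq1, eq2]
    have hpi := Real.pi_gt_d2
    nlinarith [Real.exp_one_gt_d9, hE0]
  rw [show (6 : ℝ) / (Real.exp 1 * Real.exp 1) / 2 = 3 / (Real.exp 1 * Real.exp 1) by ring]
  rw [show 2 * Real.sqrt Real.pi * (Real.exp 1 * Real.exp (1 / 2))⁻¹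
      = (2 * Real.sqrt Real.pi) / (Real.exp 1 * Real.exp (1 / 2)) from (div_eq_mul_inv _ _).symm]
  rw [div_lt_div_iff₀ (by positivity) (by positivity)]
  nlinarith [hkey, hE0, hs0]


/-- `ν_cyl = log Θ(S³×ℝ)`: the crux's literal threshold is the logarithm of the cylinder density. [folklore] -/
theorem nuCyl_eq_log_thetaCyl : nuCyl = Real.log thetaCyl := by
  unfold nuCyl thetaCyl
  have hp0 : 0 < Real.sqrt Real.pi := Real.sqrt_pos.2 Real.pi_pos
  rw [Real.log_mul (by positivity) (Real.exp_pos _).ne', Real.log_mul (by norm_num) hp0.ne',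
    Real.log_exp, Real.log_sqrt Real.pi_pos.le]
  ring

/-- `log Θ(S⁴) = log 6 − 2 = ν(S⁴_round)` (≈ −0.20824). [folklore] -/
theorem log_thetaSph : Real.log thetaSph = Real.log 6 - 2 := by
  unfold thetaSph
  rw [Real.log_div (by norm_num) (Real.exp_pos 2).ne', Real.log_exp]

/-- **The round sphere clears the threshold**: `ν_cyl < log 6 − 2` (margin .02625). [folklore] -/
theorem nuCyl_lt_nuRound : nuCyl < Real.log 6 - 2 := by
  rw [nuCyl_eq_log_thetaCyl, ← log_thetaSph]
  have h0 : 0 < thetaCyl := by unfold thetaCyl; positivity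
  exact Real.log_lt_log h0 thetaCyl_lt_thetaSph

/-- The literal constant of items 10868 / 10870, `32π²√π e^{−3/2}`, is `16π² · Θ(S³×ℝ)` (i.e. their bound reads
`(4π)⁻² ∫ e^{−f} dV ≤ Θ_cyl` / `> Θ_cyl`). [folklore] -/
theorem routeConstant_eq :
    32 * Real.pi ^ 2 * Real.sqrt Real.pi * Real.exp (-(3 : ℝ) / 2) = 16 * Real.pi ^ 2 * thetaCyl := by
  unfold thetaCyl; ring

/-- `Θ(S⁴) = 96π² e⁻² / (16π²)` (the sphere `S⁴(√6)`: `R = 2`, `f ≡ 2`, `Vol = 36·8π²/3 = 96π²`). [folklore] -/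
theorem thetaSph_eq : thetaSph = 96 * Real.pi ^ 2 * Real.exp (-2) / (16 * Real.pi ^ 2) := by
  unfold thetaSph
  rw [Real.exp_neg]
  field_simp
  ring

/-- **Bishop window for the Einstein case.** An Einstein metric on a closed 4-manifold normalised `Ric = 3g`
has `Vol ≤ Vol(S⁴(1))` (Bishop), and as a shrinker `Θ = Θ(S⁴) · Vol/Vol(S⁴(1))`; so `Θ > Θ_cyl` forces
`Vol/Vol(S⁴(1)) > Θ_cyl/Θ_sph = √(πe)/3`, certified here to lie in `(0.974, 0.9742)`: an Einstein competitor
must have more than 97.4 % of the round volume (and then Gursky's gap, `thetaEinsteinNonround_lt_thetaCyl`,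
leaves only the round metric on a homotopy sphere). [folklore] -/
theorem volRatio_window :
    0.974 < thetaCyl / thetaSph ∧ thetaCyl / thetaSph < 0.9742 := by
  have hE0 := Real.exp_pos 1
  have hs0 := Real.exp_pos (1 / 2)
  have hp0 : 0 < Real.sqrt Real.pi := Real.sqrt_pos.2 Real.pi_pos
  have hratio : thetaCyl / thetaSph = Real.sqrt Real.pi * Real.exp (1 / 2) / 3 := by
    unfold thetaCyl thetaSph
    rw [exp_neg_three_halves, exp_two_eq, ← exp_half_sq]
    field_simp
    ring
  rw [hratio]
  -- square: (√π √e / 3)² = π e / 9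
  have hsq : (Real.sqrt Real.pi * Real.exp (1 / 2) / 3) ^ 2 = Real.pi * Real.exp 1 / 9 := by
    rw [div_pow, mul_pow, sq, sq, sqrt_pi_sq, exp_half_sq]; norm_num
  have hpos : 0 < Real.sqrt Real.pi * Real.exp (1 / 2) / 3 := by positivity
  have hlo : (0.974 : ℝ) ^ 2 < Real.pi * Real.exp 1 / 9 := by
    nlinarith [Real.pi_gt_d6, Real.exp_one_gt_d9, Real.pi_pos]
  have hhi : Real.pi * Real.exp 1 / 9 < (0.9742 : ℝ) ^ 2 := by
    nlinarith [Real.pi_lt_d6, Real.exp_one_lt_d9, Real.pi_pos, hE0]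
  constructor
  · nlinarith [hsq, hlo, hpos]
  · nlinarith [hsq, hhi, hpos]

/-! ## §4 Non-vacuity: the round `S⁴` meets the PSC hypothesis with the TREE's definitions -/

/-- `finrank ℝ ℝ⁵ = 4 + 1`, as the `Fact` the sphere instances want. -/
instance factFinrankFive : Fact (Module.finrank ℝ (EuclideanSpace ℝ (Fin 5)) = 4 + 1) :=
  ⟨by simp⟩

/-- **`R > 0` is satisfiable on the summit's own `S⁴`, with the tree's `scalarCurvature`.** The round metric
of `S⁴ ⊂ ℝ⁵` is a `C^∞` Riemannian metric with Levi-Civita instance (`hasLeviCivita`, a theorem) and scalar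
curvature `12 > 0` (`scalarCurvature_roundMetric_pos`, proved from the Gauss equation in the tree; axioms
propext / Classical.choice / Quot.sound). Hence the crux is NOT vacuously provable through `hR`. [folklore] -/
theorem roundSphere_psc :
    ∃ (g : Metric4 𝕊⁴) (_ : g.HasLeviCivita), g.IsRiemannian ∧ ∀ x, 0 < g.scalarCurvature x := by
  haveI := (roundMetric (n := 4) (EuclideanSpace ℝ (Fin 5))).hasLeviCivita
  exact ⟨roundMetric (n := 4) (EuclideanSpace ℝ (Fin 5)), ‹_›, isRiemannian_roundMetric,
    fun x => scalarCurvature_roundMetric_pos _ (by norm_num) x⟩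

/-! ## §5 Near-misses (the only `sorry`s of this file; obstruction recorded) -/

/-- NEAR-MISS (not closable in the tree today): **the round `S⁴` has `ν = log 6 − 2 > ν_cyl`**, i.e. the
entropy hypothesis of the crux holds for `(S⁴, g_round)` — this is item 10871 (SubcylindricalExistence)
restricted to the standard sphere, and together with `roundSphere_psc` it is the full non-vacuity of the crux.
Informal proof (checked on paper this cycle): (i) along the shrinking flow `g(t) = (1 − 6t) g`, Perelman's
monotonicity of `t ↦ μ(g(t), S − t)` for EVERY `S > 0` plus scale invariance `μ(cg, cτ) = μ(g, τ)` gives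
`τ ↦ μ(g, τ)` non-increasing on `(0, 1/6)` and non-decreasing on `(1/6, ∞)` (`(S−t)/(1−6t)` is monotone with
sign of `6S − 1`), so `ν(g) = μ(g, 1/6)`; (ii) at the shrinker scale `τ₀ = 1/6` the minimiser is constant
(Carrillo–Ni 2009 / Bakry–Émery LSI on `Ric = 3g`), `e^{−f} = (4π/6)²/(8π²/3) = 1/6`, `μ = τ₀R + f − 4 =
2 + log 6 − 4 = log 6 − 2 ≈ −0.20824 > ν_cyl ≈ −0.23449` (`nuCyl_lt_nuRound`). Obstruction: needs
`riemannianMeasure(S⁴) = 8π²/3` (area formula, fact `riemannianMeasure_eq_integral_sqrt_det`), Perelman (T2)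
(hypothesis form only, PerelmanEntropyNoncollapsing.lean) and the sharp LSI on `S⁴`; none is in the tree. -/
theorem roundSphere_entropyAbove_nuCyl :
    haveI := (roundMetric (n := 4) (EuclideanSpace ℝ (Fin 5))).hasLeviCivita
    EntropyAbove (roundMetric (n := 4) (EuclideanSpace ℝ (Fin 5))) isRiemannian_roundMetric nuCyl := by
  sorry


/-! ## §7 Generic "any hypothesis" form and cycle-1 name aliases (cards / triage cite these names) -/

/-- A hypothesis package over the crux's binder (any `Prop` depending on `M` and its ten instances). -/
abbrev HypPack : Type 1 :=
  ∀ (M : Type) [TopologicalSpace M] [T2Space M] [SecondCountableTopology M]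
    [ChartedSpace (EuclideanSpace ℝ (Fin 4)) M] [IsManifold (𝓡 4) ∞ M] [CompactSpace M] [T3Space M]
    [MeasurableSpace M] [BorelSpace M], Prop

/-- `RecognitionFrom H`: "`M ≃ₕ S⁴` and `H M` ⇒ `M ≅ S⁴`" — the crux with its metric hypotheses replaced by an ARBITRARY
package `H` (e.g. any strengthening/weakening of `R > 0 ∧ ν > c`, curvature pinching, stability clauses, …). -/
def RecognitionFrom (H : HypPack) : Prop :=
  ∀ (M : Type) [TopologicalSpace M] [T2Space M] [SecondCountableTopology M]
    [ChartedSpace (EuclideanSpace ℝ (Fin 4)) M] [IsManifold (𝓡 4) ∞ M] [CompactSpace M] [T3Space M]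
    [MeasurableSpace M] [BorelSpace M],
    M ≃ₕ 𝕊⁴ → H M → Nonempty (M ≃ₘ⟮𝓡 4, 𝓡 4⟯ 𝕊⁴)

/-- **SPC4 ⇒ `RecognitionFrom H` for EVERY hypothesis package `H`**: no mutation on the hypothesis side of the crux
(keeping `M ≃ₕ S⁴ → … → M ≅ S⁴`) can ever be refuted short of exhibiting an exotic 4-sphere. This is the licence the
`entropy-ratchet` / `stable-window-genericity` lines use to move `g` freely. [folklore] -/
theorem spc4_imp_anyHyp (h : _root_.SmoothPoincare4) (H : HypPack) : RecognitionFrom H :=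
  fun M _ _ _ _ _ _ _ _ _ e _ => h M ‹_› ‹_› e

/-- The crux is `RecognitionFrom` of its own metric package. [folklore] -/
theorem recognition_eq_recognitionFrom (c : ℝ) :
    Recognition c ↔ RecognitionFrom (fun M _ _ _ _ _ _ _ _ _ =>
      ∃ (g : Metric4 M) (_ : g.HasLeviCivita) (hg : g.IsRiemannian),
        (∀ x : M, 0 < g.scalarCurvature x) ∧ EntropyAbove g hg c) := by
  constructor
  · rintro h M _ _ _ _ _ _ _ _ _ e ⟨g, iLC, hg, hR, hν⟩
    exact h M e g hg hR hν
  · intro h M _ _ _ _ _ _ _ _ _ e g iLC hg hR hν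
    exact h M e ⟨g, iLC, hg, hR, hν⟩

/-- cycle-1 name: `iff_exoticFree`. [folklore] -/
theorem iff_exoticFree : SubcylindricalRecognition ↔ NoSupercylindricalExotic nuCyl :=
  recognition_nuCyl_iff.symm.trans (recognition_iff_noExotic nuCyl)

/-- cycle-1 name: `false_without_homotopyEquiv` (at the crux threshold). [folklore] -/
theorem false_without_homotopyEquiv : ¬ RecognitionWithoutHomotopyEquiv nuCyl :=
  recognitionWithoutHomotopyEquiv_false nuCyl

/-- cycle-1 name: `gRound_psc`. [folklore] -/
theorem gRound_psc :
    ∃ (g : Metric4 𝕊⁴) (_ : g.HasLeviCivita), g.IsRiemannian ∧ ∀ x, 0 < g.scalarCurvature x :=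
  roundSphere_psc

/-! ## §8 Targets — line `ancient-sphere-rigidity`, reshape r2 (skeleton sha 90cf9aa3e986…) -/

section Targets

/-- The CONCLUSION of the registered stub `stub_blowdown` (Lines/ancient-sphere-rigidity.lean, r2),
verbatim, as a predicate of the closed manifold `M` alone: a complete connected normalised gradient
shrinker `(S, g_S, f_S)` with `R ≢ 0` and `∫ e^{-f_S} dV > 32π²√π e^{-3/2}`, which, if compact,
immerses injectively into `M`. NOTE: the data `(A, g_k, cov_k, x_k, κ, δ', c)` of the stub do not occur. -/
def BlowdownConclusion (M : Type) [TopologicalSpace M] [ChartedSpace (EuclideanSpace ℝ (Fin 4)) M]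
    [IsManifold (𝓡 4) ∞ M] : Prop :=
  ∃ (S : Type) (_ : TopologicalSpace S) (_ : T2Space S) (_ : SecondCountableTopology S)
    (_ : ChartedSpace (EuclideanSpace ℝ (Fin 4)) S) (_ : IsManifold (𝓡 4) ∞ S) (_ : ConnectedSpace S)
    (_ : T3Space S) (_ : MeasurableSpace S) (_ : BorelSpace S)
    (gS : PseudoRiemannianMetric (𝓡 4) ∞ (EuclideanSpace ℝ (Fin 4)) (TangentSpace (𝓡 4) : S → Type _))
    (_ : gS.HasLeviCivita) (fS : S → ℝ) (hS : gS.IsRiemannian),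
    (∀ (x : S) (r : NNReal), IsCompact {y : S | gS.edist hS x y ≤ r}) ∧
    ContMDiff (𝓡 4) 𝓘(ℝ, ℝ) ∞ fS ∧
    (∀ (x : S) (X Y : TangentSpace (𝓡 4) x),
      gS.ricci x X Y + gS.hessian fS x X Y = (1 / 2 : ℝ) * gS.val x X Y) ∧
    (∀ x : S, gS.scalarCurvature x + gS.gradSq fS x = fS x) ∧
    (∃ x : S, gS.scalarCurvature x ≠ 0) ∧
    ENNReal.ofReal (32 * Real.pi ^ 2 * Real.sqrt Real.pi * Real.exp (-(3 : ℝ) / 2)) <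
      ∫⁻ x, ENNReal.ofReal (Real.exp (-fS x))
        ∂(riemannianMeasure (gS.toContMDiffRiemannianMetric hS)) ∧
    (CompactSpace S → ∃ φ : S → M, ContMDiff (𝓡 4) (𝓡 4) ∞ φ ∧ Function.Injective φ ∧
      ∀ x : S, Function.Injective (mfderiv (𝓡 4) (𝓡 4) φ x))

/-- The registered stub `stub_blowdown` (r2) VERBATIM (hypotheses + conclusion), as a `Prop`. -/
def StubBlowdown : Prop :=
    ∀ (M : Type) [TopologicalSpace M] [T2Space M] [SecondCountableTopology M]
      [ChartedSpace (EuclideanSpace ℝ (Fin 4)) M] [IsManifold (𝓡 4) ∞ M] [CompactSpace M]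
      [ConnectedSpace M] [T3Space M] [MeasurableSpace M] [BorelSpace M]
      (A : ℕ → ℝ)
      (gk : ℕ → ℝ → PseudoRiemannianMetric (𝓡 4) ∞ (EuclideanSpace ℝ (Fin 4)) (TangentSpace (𝓡 4) : M → Type _))
      (covk : ℕ → ℝ → CovariantDerivative (𝓡 4) (EuclideanSpace ℝ (Fin 4)) (TangentSpace (𝓡 4) : M → Type _))
      (xk : ℕ → M) (κ δ' c : ℝ), 0 < κ → 0 < δ' → 0 < c →
      (∀ k : ℕ, (k : ℝ) ≤ A k) →
      (∀ k, IsRicciFlow (gk k) (covk k) (Set.Icc (-(A k)) 0)) →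
      (∀ k, ∀ t ∈ Set.Icc (-(A k)) 0, (gk k t).IsRiemannian) →
      (∀ k, ∀ t ∈ Set.Icc (-(A k)) 0, CurvatureBoundedBy (gk k t) (covk k t) 1) →
      (∀ k, ∃ X Y Z W : TangentSpace (𝓡 4) (xk k),
        (gk k 0).val (xk k) X X ≤ 1 ∧ (gk k 0).val (xk k) Y Y ≤ 1 ∧
        (gk k 0).val (xk k) Z Z ≤ 1 ∧ (gk k 0).val (xk k) W W ≤ 1 ∧
        c ≤ |(gk k 0).curvatureForm (covk k 0) (xk k) X Y Z W|) →
      (∀ k, ∀ r₀ : ℝ, 0 < r₀ → r₀ < Real.sqrt (A k) →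
        IsKappaNoncollapsed (gk k) (covk k) (Set.Icc (-(A k)) 0) κ r₀) →
      (∀ k, ∀ t ∈ Set.Icc (-(A k)) 0, ∀ τ : ℝ, 0 < τ →
        ((Real.log 2 + Real.log Real.pi / 2 - 3 / 2 + δ' : ℝ) : EReal) ≤
          (gk k t).muEntropy (covk k t) τ) →
      ∃ (S : Type) (_ : TopologicalSpace S) (_ : T2Space S) (_ : SecondCountableTopology S)
        (_ : ChartedSpace (EuclideanSpace ℝ (Fin 4)) S) (_ : IsManifold (𝓡 4) ∞ S) (_ : ConnectedSpace S)
        (_ : T3Space S) (_ : MeasurableSpace S) (_ : BorelSpace S)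
        (gS : PseudoRiemannianMetric (𝓡 4) ∞ (EuclideanSpace ℝ (Fin 4)) (TangentSpace (𝓡 4) : S → Type _))
        (_ : gS.HasLeviCivita) (fS : S → ℝ) (hS : gS.IsRiemannian),
        (∀ (x : S) (r : NNReal), IsCompact {y : S | gS.edist hS x y ≤ r}) ∧
        ContMDiff (𝓡 4) 𝓘(ℝ, ℝ) ∞ fS ∧
        (∀ (x : S) (X Y : TangentSpace (𝓡 4) x),
          gS.ricci x X Y + gS.hessian fS x X Y = (1 / 2 : ℝ) * gS.val x X Y) ∧
        (∀ x : S, gS.scalarCurvature x + gS.gradSq fS x = fS x) ∧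
        (∃ x : S, gS.scalarCurvature x ≠ 0) ∧
        ENNReal.ofReal (32 * Real.pi ^ 2 * Real.sqrt Real.pi * Real.exp (-(3 : ℝ) / 2)) <
          ∫⁻ x, ENNReal.ofReal (Real.exp (-fS x))
            ∂(riemannianMeasure (gS.toContMDiffRiemannianMetric hS)) ∧
        (CompactSpace S → ∃ φ : S → M, ContMDiff (𝓡 4) (𝓡 4) ∞ φ ∧ Function.Injective φ ∧
          ∀ x : S, Function.Injective (mfderiv (𝓡 4) (𝓡 4) φ x))

/-- The stub is "hypotheses ⇒ `BlowdownConclusion M`" (definitional bookkeeping). [folklore] -/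
theorem stubBlowdown_iff : StubBlowdown ↔
    ∀ (M : Type) [TopologicalSpace M] [T2Space M] [SecondCountableTopology M]
      [ChartedSpace (EuclideanSpace ℝ (Fin 4)) M] [IsManifold (𝓡 4) ∞ M] [CompactSpace M]
      [ConnectedSpace M] [T3Space M] [MeasurableSpace M] [BorelSpace M]
      (A : ℕ → ℝ)
      (gk : ℕ → ℝ → PseudoRiemannianMetric (𝓡 4) ∞ (EuclideanSpace ℝ (Fin 4)) (TangentSpace (𝓡 4) : M → Type _))
      (covk : ℕ → ℝ → CovariantDerivative (𝓡 4) (EuclideanSpace ℝ (Fin 4)) (TangentSpace (𝓡 4) : M → Type _))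
      (xk : ℕ → M) (κ δ' c : ℝ), 0 < κ → 0 < δ' → 0 < c →
      (∀ k : ℕ, (k : ℝ) ≤ A k) →
      (∀ k, IsRicciFlow (gk k) (covk k) (Set.Icc (-(A k)) 0)) →
      (∀ k, ∀ t ∈ Set.Icc (-(A k)) 0, (gk k t).IsRiemannian) →
      (∀ k, ∀ t ∈ Set.Icc (-(A k)) 0, CurvatureBoundedBy (gk k t) (covk k t) 1) →
      (∀ k, ∃ X Y Z W : TangentSpace (𝓡 4) (xk k),
        (gk k 0).val (xk k) X X ≤ 1 ∧ (gk k 0).val (xk k) Y Y ≤ 1 ∧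
        (gk k 0).val (xk k) Z Z ≤ 1 ∧ (gk k 0).val (xk k) W W ≤ 1 ∧
        c ≤ |(gk k 0).curvatureForm (covk k 0) (xk k) X Y Z W|) →
      (∀ k, ∀ r₀ : ℝ, 0 < r₀ → r₀ < Real.sqrt (A k) →
        IsKappaNoncollapsed (gk k) (covk k) (Set.Icc (-(A k)) 0) κ r₀) →
      (∀ k, ∀ t ∈ Set.Icc (-(A k)) 0, ∀ τ : ℝ, 0 < τ →
        ((Real.log 2 + Real.log Real.pi / 2 - 3 / 2 + δ' : ℝ) : EReal) ≤
          (gk k t).muEntropy (covk k t) τ) →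
      BlowdownConclusion M :=
  Iff.rfl

/-- **DECOUPLING (the conclusion of `stub_blowdown` is free on any `M ≅ S⁴`).** Whatever the blow-up
data, if `M` is diffeomorphic to the standard `S⁴` then `BlowdownConclusion M` holds with the ROUND
shrinker `S⁴(√6)` (`6·g_{S⁴}`, `f ≡ 2`, `R = 2`, `∫e^{-2}dV = 96π²e⁻² > 32π²√π e^{-3/2}`; all proved in
`Literature/Geometry/Riemannian/ShrinkingRoundSphereFour.lean`) and the diffeomorphism as the injective
immersion. So the Bamler stub carries information ONLY through manifolds `M` not (known to be)
diffeomorphic to `S⁴` — on its one use in the composition (`M ≃ₕ S⁴`) it is SPC4-trivialisable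
(`spc4_imp_blowdownConclusion`), exactly like the crux (`spc4_imp`). A "proof" of `stub_blowdown` by
case split on `Nonempty (S⁴ ≃ₘ M)` is therefore worthless for the crux; the genuine (Bamler 2020a–c /
BCDMZ) argument is needed precisely for the `M` where SPC4 is open. [folklore] -/
theorem blowdownConclusion_of_sphereDiffeo (M : Type) [TopologicalSpace M]
    [ChartedSpace (EuclideanSpace ℝ (Fin 4)) M] [IsManifold (𝓡 4) ∞ M]
    (e : SphereFour ≃ₘ⟮𝓡 4, 𝓡 4⟯ M) : BlowdownConclusion M := by
  have hpt : SphereFour := ⟨EuclideanSpace.single 0 1, by simp⟩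
  refine ⟨SphereFour, inferInstance, inferInstance, inferInstance, inferInstance, inferInstance,
    inferInstance, inferInstance, inferInstance, inferInstance, shrinkingSphereFourMetric,
    instHasLeviCivitaShrinkingSphereFour, fun _ => 2, isRiemannian_shrinkingSphereFourMetric,
    isCompact_setOf_edist_shrinkingSphereFour_le, contMDiff_const, ?_, ?_, ?_, ?_, ?_⟩
  · intro x X Y
    rw [ricci_shrinkingSphereFourMetric, PseudoRiemannianMetric.hessian_constFun]
    simp
  · intro x
    rw [scalarCurvature_shrinkingSphereFourMetric, PseudoRiemannianMetric.gradSq_const]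
    norm_num
  · exact ⟨hpt, by rw [scalarCurvature_shrinkingSphereFourMetric]; norm_num⟩
  · have h := lintegral_exp_neg_two_shrinkingSphereFour
    simp only [] at h ⊢
    rw [show (fun _ : SphereFour => ENNReal.ofReal (Real.exp (-(2 : ℝ)))) =
        fun _ : SphereFour => ENNReal.ofReal (Real.exp (-2)) from rfl] at h
    rw [h]
    exact (ENNReal.ofReal_lt_ofReal_iff (by positivity)).2 cylinderDensityBound_lt_shrinkingSphereFour
  · intro _
    exact ⟨e, e.contMDiff, e.injective, fun x => (e.mfderivToContinuousLinearEquiv (by simp) x).injective⟩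

/-- The conclusion of `stub_blowdown` holds OUTRIGHT on the standard `S⁴`. [folklore] -/
theorem blowdownConclusion_sphere : BlowdownConclusion SphereFour :=
  blowdownConclusion_of_sphereDiffeo SphereFour (Diffeomorph.refl _ _ _)

/-- **SPC4 ⇒ the conclusion of `stub_blowdown` for every `M ≃ₕ S⁴`, hypotheses unused.** [folklore] -/
theorem spc4_imp_blowdownConclusion (h : _root_.SmoothPoincare4) (M : Type) [TopologicalSpace M]
    [T2Space M] [SecondCountableTopology M] [ChartedSpace (EuclideanSpace ℝ (Fin 4)) M]
    [IsManifold (𝓡 4) ∞ M] (e : M ≃ₕ 𝕊⁴) : BlowdownConclusion M := by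
  obtain ⟨φ⟩ := h M ‹_› ‹_› e
  exact blowdownConclusion_of_sphereDiffeo M φ.symm

/-- `stub_blowdown` restricted to the standard sphere holds with all eleven hypotheses idle. [folklore] -/
theorem stubBlowdown_onSphere
    (A : ℕ → ℝ) (gk : ℕ → ℝ → Metric4 SphereFour)
    (covk : ℕ → ℝ → CovariantDerivative (𝓡 4) (EuclideanSpace ℝ (Fin 4))
      (TangentSpace (𝓡 4) : SphereFour → Type _))
    (xk : ℕ → SphereFour) (κ δ' c : ℝ) : 0 < κ → 0 < δ' → 0 < c →
      (∀ k : ℕ, (k : ℝ) ≤ A k) →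
      (∀ k, IsRicciFlow (gk k) (covk k) (Set.Icc (-(A k)) 0)) →
      (∀ k, ∀ t ∈ Set.Icc (-(A k)) 0, (gk k t).IsRiemannian) →
      (∀ k, ∀ t ∈ Set.Icc (-(A k)) 0, CurvatureBoundedBy (gk k t) (covk k t) 1) →
      (∀ k, ∃ X Y Z W : TangentSpace (𝓡 4) (xk k),
        (gk k 0).val (xk k) X X ≤ 1 ∧ (gk k 0).val (xk k) Y Y ≤ 1 ∧
        (gk k 0).val (xk k) Z Z ≤ 1 ∧ (gk k 0).val (xk k) W W ≤ 1 ∧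
        c ≤ |(gk k 0).curvatureForm (covk k 0) (xk k) X Y Z W|) →
      (∀ k, ∀ r₀ : ℝ, 0 < r₀ → r₀ < Real.sqrt (A k) →
        IsKappaNoncollapsed (gk k) (covk k) (Set.Icc (-(A k)) 0) κ r₀) →
      (∀ k, ∀ t ∈ Set.Icc (-(A k)) 0, ∀ τ : ℝ, 0 < τ →
        ((Real.log 2 + Real.log Real.pi / 2 - 3 / 2 + δ' : ℝ) : EReal) ≤
          (gk k t).muEntropy (covk k t) τ) →
      BlowdownConclusion SphereFour :=
  fun _ _ _ _ _ _ _ _ _ _ => blowdownConclusion_sphere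

/-! ### 8.2 The `κ`-noncollapsing hypothesis of `stub_blowdown` is implied by its entropy floor -/

universe uE uH uM in
/-- **A uniform `μ`-floor gives `κ`-noncollapsing at EVERY scale, with `κ` depending only on the floor
and the dimension** (Perelman 2002 §4 / Topping 2006 Thm. 8.3.4, (8.3.11), run on ONE slice: the tree's
`entropyDichotomy_of_le_muEntropy` with the universal cutoffs `exists_metric_cutoff` and the halving
iteration `ofReal_mul_pow_le_vol_ball_of_doubling`). For every real `m` there is `κ = κ(m, dim) > 0`
such that for every closed manifold `M`, every family `(g, cov)` and time set `S` whose slices are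
Riemannian with `cov t` Levi-Civita and `m ≤ μ(g t, cov t, τ)` for ALL `τ > 0`, the family is
`κ`-noncollapsed on `S` at every scale `r₀ > 0` (parabolic form `IsKappaNoncollapsed`; only the final
slice of the parabolic region is used). No flow equation, no monotonicity, no `√T` restriction. [folklore] -/
theorem isKappaNoncollapsed_of_muFloor
    {E : Type uE} [NormedAddCommGroup E] [NormedSpace ℝ E] [FiniteDimensional ℝ E]
    {H : Type uH} [TopologicalSpace H] (I : ModelWithCorners ℝ E H) [I.Boundaryless] (m : ℝ) :
    ∃ κ : ℝ, 0 < κ ∧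
      ∀ (M : Type uM) [TopologicalSpace M] [T2Space M] [SecondCountableTopology M] [CompactSpace M]
        [ChartedSpace H M] [IsManifold I ∞ M] [T3Space M] [MeasurableSpace M] [BorelSpace M]
        (g : ℝ → PseudoRiemannianMetric I ∞ E (TangentSpace I : M → Type _))
        (cov : ℝ → CovariantDerivative I E (TangentSpace I : M → Type _)) (S : Set ℝ),
        (∀ t ∈ S, (g t).IsRiemannian) → (∀ t ∈ S, (g t).IsLeviCivita (cov t)) →
        (∀ t ∈ S, ∀ τ : ℝ, 0 < τ → (m : EReal) ≤ (g t).muEntropy (cov t) τ) →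
        ∀ r₀ : ℝ, 0 < r₀ → IsKappaNoncollapsed g cov S κ r₀ := by
  haveI : CompleteSpace E := FiniteDimensional.complete ℝ E
  obtain ⟨C₀, hC₀⟩ := exists_metric_cutoff.{uE, uH, uM}
  set n := Module.finrank ℝ E with hn
  refine ⟨(Real.pi / 9) ^ ((n : ℝ) / 2) *
      Real.exp (m + n - (C₀ / 9 + (n : ℝ) ^ 2) * 2 ^ (n + 1)), by positivity, ?_⟩
  intro M _ _ _ _ _ _ _ _ _ g cov S hRiem hLC hfloor r₀ hr₀ x₀ t₀ hS hcurv
  have ht₀I : t₀ ∈ Icc (t₀ - r₀ ^ 2) t₀ := ⟨by nlinarith, le_rfl⟩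
  have ht₀ : t₀ ∈ S := hS ht₀I
  have hG : (g t₀).IsRiemannian := hRiem t₀ ht₀
  have hRc : Continuous fun x ↦ (g t₀).scalarCurvatureWith (cov t₀) x :=
    (contMDiff_scalarCurvatureWith_holds I M (g t₀) (cov t₀) (hLC t₀ ht₀)).continuous
  refine PseudoRiemannianMetric.ofReal_mul_pow_le_vol_ball_of_doubling hG x₀ hr₀ (by positivity)
    fun s hs hsr hdoub ↦ ?_
  obtain ⟨χ, hχs, hχ0, hχ1, hχB, hχsupp, hχK⟩ := hC₀ I M (g t₀) hG x₀ s hs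
  refine entropyDichotomy_of_le_muEntropy hG hRc hs hχs hχ0 hχ1 hχB hχsupp hχK
    (hfloor t₀ ht₀ _ (by positivity)) ?_ hdoub
  refine (hcurv t₀ ht₀I).mono
    (PseudoRiemannianMetric.ball_mono _ _ (ENNReal.ofReal_le_ofReal hsr)) ?_
  gcongr

/-- **Hypothesis (6) of `stub_blowdown` (uniform `κ`-noncollapsing below `√A_k`) follows from hypotheses
(2) [Ricci flow ⇒ Levi-Civita slices], (3) [Riemannian] and (7) [the floor `μ ≥ ν_cyl + δ'`]** — in the
stronger form: ALL scales `r₀ > 0`, one `κ = κ(δ')` for every `k` and every closed `M⁴`. Information for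
the lead: `hnc`/`hκ` are removable from `stub_blowdown`, and the NLC clauses of `stub_singularFlow`
(Perelman's Thm 4.1) and `stub_rescaledSequence` are then not needed by the chain at all — the crux's
floor hypothesis is itself a no-local-collapsing statement. [folklore] -/
theorem stubBlowdown_nlc_of_floor (δ' : ℝ) : ∃ κ : ℝ, 0 < κ ∧
    ∀ (M : Type) [TopologicalSpace M] [T2Space M] [SecondCountableTopology M]
      [ChartedSpace (EuclideanSpace ℝ (Fin 4)) M] [IsManifold (𝓡 4) ∞ M] [CompactSpace M]
      [T3Space M] [MeasurableSpace M] [BorelSpace M]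
      (A : ℕ → ℝ) (gk : ℕ → ℝ → Metric4 M)
      (covk : ℕ → ℝ → CovariantDerivative (𝓡 4) (EuclideanSpace ℝ (Fin 4)) (TangentSpace (𝓡 4) : M → Type _)),
      (∀ k, IsRicciFlow (gk k) (covk k) (Set.Icc (-(A k)) 0)) →
      (∀ k, ∀ t ∈ Set.Icc (-(A k)) 0, (gk k t).IsRiemannian) →
      (∀ k, ∀ t ∈ Set.Icc (-(A k)) 0, ∀ τ : ℝ, 0 < τ →
        ((Real.log 2 + Real.log Real.pi / 2 - 3 / 2 + δ' : ℝ) : EReal) ≤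
          (gk k t).muEntropy (covk k t) τ) →
      ∀ k, ∀ r₀ : ℝ, 0 < r₀ → IsKappaNoncollapsed (gk k) (covk k) (Set.Icc (-(A k)) 0) κ r₀ := by
  obtain ⟨κ, hκ, H⟩ := isKappaNoncollapsed_of_muFloor.{0, 0, 0} (𝓡 4)
    (Real.log 2 + Real.log Real.pi / 2 - 3 / 2 + δ')
  refine ⟨κ, hκ, fun M _ _ _ _ _ _ _ _ _ A gk covk hflow hRiem hfloor k r₀ hr₀ ↦ ?_⟩
  exact H M (gk k) (covk k) (Set.Icc (-(A k)) 0) (hRiem k)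
    (fun t ht ↦ (hflow k).isLeviCivita t ht) (hfloor k) r₀ hr₀

/-! ### 8.3 Tightness at the round sphere: the admissible gap is `< 0.0267` -/

/-- `𝒲(g_{S⁴(1)}, f ≡ log 6, τ = 1/6) = log 6 − 2` and the constant `log 6` is compatible at `τ = 1/6`
(`(4π/6)⁻² e^{−log 6} · Vol(S⁴) = (36/16π²)(1/6)(8π²/3) = 1`), in the crux's unfolded typing, for the
unit round metric with `R = 12` (`scalarCurvature_roundMetric`) and `Vol = 8π²/3`
(`riemannianMeasure_roundMetric_sphere_four_univ`). [folklore] -/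
theorem roundSphere_const_compatible_and_W :
    (∫ x, (4 * Real.pi * (1 / 6 : ℝ)) ^ (-(4 : ℝ) / 2) * Real.exp (-(fun _ : SphereFour => Real.log 6) x)
        ∂(riemannianMeasure ((roundMetric (n := 4) EuclideanFive).toContMDiffRiemannianMetric
          isRiemannian_roundMetric)) = 1) ∧
    (∫ x, ((1 / 6 : ℝ) * ((roundMetric (n := 4) EuclideanFive).scalarCurvature x +
          (roundMetric (n := 4) EuclideanFive).gradSq (fun _ : SphereFour => Real.log 6) x) +
          (fun _ : SphereFour => Real.log 6) x - 4) *
        ((4 * Real.pi * (1 / 6 : ℝ)) ^ (-(4 : ℝ) / 2) * Real.exp (-(fun _ : SphereFour => Real.log 6) x))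
        ∂(riemannianMeasure ((roundMetric (n := 4) EuclideanFive).toContMDiffRiemannianMetric
          isRiemannian_roundMetric)) = Real.log 6 - 2) := by
  have hvol : (riemannianMeasure ((roundMetric (n := 4) EuclideanFive).toContMDiffRiemannianMetric
      isRiemannian_roundMetric)).real univ = 8 * Real.pi ^ 2 / 3 := by
    rw [Measure.real, riemannianMeasure_roundMetric_sphere_four_univ EuclideanFive,
      ENNReal.toReal_ofReal (by positivity)]
  have hrpow : (4 * Real.pi * (1 / 6 : ℝ)) ^ (-(4 : ℝ) / 2) = ((4 * Real.pi * (1 / 6)) ^ 2)⁻¹ := by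
    rw [show (-(4 : ℝ) / 2) = -(2 : ℝ) by norm_num, Real.rpow_neg (by positivity),
      Real.rpow_two]
  have hexp : Real.exp (-Real.log 6) = 1 / 6 := by
    rw [Real.exp_neg, Real.exp_log (by norm_num)]; ring
  have hu : (4 * Real.pi * (1 / 6 : ℝ)) ^ (-(4 : ℝ) / 2) * Real.exp (-Real.log 6) =
      (8 * Real.pi ^ 2 / 3)⁻¹ := by
    rw [hrpow, hexp]
    field_simp
    ring
  have hπ := Real.pi_pos
  constructor
  · simp only []
    rw [integral_const, smul_eq_mul, hvol, hu]
    field_simp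
  · simp only [scalarCurvature_roundMetric, PseudoRiemannianMetric.gradSq_const]
    rw [integral_const, smul_eq_mul, hvol, hu]
    have h8 : ∀ K : ℝ, 8 * Real.pi ^ 2 / 3 * (K * (8 * Real.pi ^ 2 / 3)⁻¹) = K := fun K => by
      field_simp
    rw [h8]
    push_cast
    ring

/-- **TIGHTNESS at the round `S⁴`.** If the unit round metric satisfies the crux's entropy clause with
threshold `c` and gap `δ` (`EntropyAbove`-shape, unfolded), then `c + δ ≤ log 6 − 2 = ν_round`: test the
clause at the shrinker scale `τ = 1/6` with the compatible constant `f ≡ log 6`. Hence at the crux's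
threshold `c = ν_cyl` the admissible gap is `δ ≤ log 6 − 2 − ν_cyl < 0.0267` (`gap_window`), and NO gap
is admissible at the threshold `ν_round` itself (`not_entropyAbove_round_nuRound`): the usable threshold
window for the round sphere is `[ν_cyl, ν_round)`, of width `< 0.0267` — i.e. `μ(g_{S⁴}, 1/6) ≤ log 6 − 2`,
so `ν(S⁴_round) ≤ log 6 − 2` holds in the tree's typing (the reverse inequality is the near-miss §5). [folklore] -/
theorem roundSphere_gap_le {c δ : ℝ}
    (h : ∀ τ : ℝ, 0 < τ → ∀ f : SphereFour → ℝ, ContMDiff (𝓡 4) 𝓘(ℝ, ℝ) ∞ f →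
      ∫ x, (4 * Real.pi * τ) ^ (-(4 : ℝ) / 2) * Real.exp (-f x)
        ∂(riemannianMeasure ((roundMetric (n := 4) EuclideanFive).toContMDiffRiemannianMetric
          isRiemannian_roundMetric)) = 1 →
      c + δ ≤ ∫ x, (τ * ((roundMetric (n := 4) EuclideanFive).scalarCurvature x +
          (roundMetric (n := 4) EuclideanFive).gradSq f x) + f x - 4) *
        ((4 * Real.pi * τ) ^ (-(4 : ℝ) / 2) * Real.exp (-f x))
        ∂(riemannianMeasure ((roundMetric (n := 4) EuclideanFive).toContMDiffRiemannianMetric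
          isRiemannian_roundMetric))) :
    c + δ ≤ Real.log 6 - 2 := by
  obtain ⟨h1, h2⟩ := roundSphere_const_compatible_and_W
  have := h (1 / 6) (by norm_num) (fun _ => Real.log 6) contMDiff_const h1
  rwa [h2] at this


/-! ### 8.4 The other four registered stubs, verbatim, with verdicts — THREE of the five stubs are PROVED
(`stub_pointPicking`, `stub_rescaledSequence`: proofs attached to the item; `stub_compactModelRecognition`: below);
what remains of the line is `stub_singularFlow` (named facts: short-time existence, Perelman (T2)) and
`stub_blowdown` (Bamler 2020a–c / BCDMZ). -/

/-- The registered stub `stub_singularFlow` (r2) VERBATIM. VERDICT (cycle 3): SURVIVES all cheap attacks;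
TRUE modulo the named facts it is declared conditional on (`ricciFlow_shortTime_existence`, Perelman (T2)).
Checked: (i) hypotheses are genuine on a closed `M` — `f` smooth, `R` continuous, finite Riemannian measure,
so both Bochner integrals are the printed `∫u dV` / `𝒲(g,f,τ)` (no junk-`0` escape); `M ≠ ∅`
(`ConnectedSpace`), so the cycle-2 `Empty` kill does not apply; (ii) the blow-up clause `∀ C ∃ t₀ ∀ t ∈ [t₀,T)`
is the `lim` (not `limsup`) form — correct (Topping Thm 5.3.2 / tree `ricciFlow_curvature_blowup`: doubling
time); (iii) the floor along the flow with the SAME `δ` is (T2) at scale `τ + t`: `μ(g(t),τ) ≥ μ(g₀,τ+t) ≥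
ν_cyl + δ` — it consumes the crux hypothesis at ALL scales, not only `τ ≤ T` (mechanism note 3 of §6 is for
the singular-slice line, not this one); (iv) the NLC clause of the conclusion is REDUNDANT: it follows from
the floor clause by `isKappaNoncollapsed_of_muFloor` (§8.2), at all scales, so Perelman's Thm 4.1 /
`exists_isKappaNoncollapsed_of_muMonotone` need not be invoked by this line at all. -/
def StubSingularFlow : Prop :=
    ∀ (M : Type) [TopologicalSpace M] [T2Space M] [SecondCountableTopology M]
      [ChartedSpace (EuclideanSpace ℝ (Fin 4)) M] [IsManifold (𝓡 4) ∞ M] [CompactSpace M]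
      [ConnectedSpace M] [T3Space M] [MeasurableSpace M] [BorelSpace M]
      (g₀ : PseudoRiemannianMetric (𝓡 4) ∞ (EuclideanSpace ℝ (Fin 4)) (TangentSpace (𝓡 4) : M → Type _))
      [g₀.HasLeviCivita] (hg₀ : g₀.IsRiemannian),
      (∀ x : M, 0 < g₀.scalarCurvature x) →
      ∀ δ : ℝ, 0 < δ →
      (∀ τ : ℝ, 0 < τ → ∀ f : M → ℝ, ContMDiff (𝓡 4) 𝓘(ℝ, ℝ) ∞ f →
        ∫ x, (4 * Real.pi * τ) ^ (-(4 : ℝ) / 2) * Real.exp (-f x)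
          ∂(riemannianMeasure (g₀.toContMDiffRiemannianMetric hg₀)) = 1 →
        Real.log 2 + Real.log Real.pi / 2 - 3 / 2 + δ ≤
          ∫ x, (τ * (g₀.scalarCurvature x + g₀.gradSq f x) + f x - 4) *
            ((4 * Real.pi * τ) ^ (-(4 : ℝ) / 2) * Real.exp (-f x))
            ∂(riemannianMeasure (g₀.toContMDiffRiemannianMetric hg₀))) →
      ∃ (T κ : ℝ), 0 < κ ∧
        ∃ (g : ℝ → PseudoRiemannianMetric (𝓡 4) ∞ (EuclideanSpace ℝ (Fin 4)) (TangentSpace (𝓡 4) : M → Type _))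
          (cov : ℝ → CovariantDerivative (𝓡 4) (EuclideanSpace ℝ (Fin 4)) (TangentSpace (𝓡 4) : M → Type _)),
          IsMaximalRicciFlow g cov T ∧ g 0 = g₀ ∧
          (∀ C : ℝ, ∃ t₀ ∈ Set.Ico 0 T, ∀ t ∈ Set.Ico t₀ T, ¬ CurvatureBoundedBy (g t) (cov t) C) ∧
          (∀ r₀ : ℝ, 0 < r₀ → r₀ < Real.sqrt T → IsKappaNoncollapsed g cov (Set.Ico 0 T) κ r₀) ∧
          (∀ t ∈ Set.Ico 0 T, ∀ τ : ℝ, 0 < τ →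
            ((Real.log 2 + Real.log Real.pi / 2 - 3 / 2 + δ : ℝ) : EReal) ≤
              (g t).muEntropy (cov t) τ)

/-- The registered stub `stub_pointPicking` (r2) VERBATIM. VERDICT: TRUE — PROVED this cycle (sorry-free candidate
proof `PointPicking.lean` attached to the item, namespace `…AncientSphereRigidity`, standard axioms; the lead's
sketch checks: `Q_k :=` the sup of `|Rm|` over unit-bounded quadruples on `M × [0,t']`, finite by
`IsRicciFlow.exists_curvatureBoundedBy_Icc`, `> max(2K₀, 4k/T) ≥ 0` once the bound is violated at `t' < T`, so
`0 < Q_k` and a quadruple with value `≥ Q_k/2 > K₀` exists and lives at a time `t_k > T/2`, whence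
`Q_k t_k ≥ 2k`). No junk instance: `M ≠ ∅`; a flat flow never violates a bound; `X = 0` quadruples give `0`. -/
def StubPointPicking : Prop :=
    ∀ (M : Type) [TopologicalSpace M] [T2Space M] [SecondCountableTopology M]
      [ChartedSpace (EuclideanSpace ℝ (Fin 4)) M] [IsManifold (𝓡 4) ∞ M] [CompactSpace M]
      [ConnectedSpace M] [T3Space M] [MeasurableSpace M] [BorelSpace M] (T : ℝ)
      (g : ℝ → PseudoRiemannianMetric (𝓡 4) ∞ (EuclideanSpace ℝ (Fin 4)) (TangentSpace (𝓡 4) : M → Type _))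
      (cov : ℝ → CovariantDerivative (𝓡 4) (EuclideanSpace ℝ (Fin 4)) (TangentSpace (𝓡 4) : M → Type _)),
      IsMaximalRicciFlow g cov T →
      (∀ C : ℝ, ∃ t₀ ∈ Set.Ico 0 T, ∀ t ∈ Set.Ico t₀ T, ¬ CurvatureBoundedBy (g t) (cov t) C) →
      ∃ (tk Qk : ℕ → ℝ) (xk : ℕ → M),
        (∀ k, tk k ∈ Set.Ico 0 T) ∧ (∀ k, 0 < Qk k) ∧ (∀ k : ℕ, (k : ℝ) ≤ Qk k * tk k) ∧
        (∀ k, ∀ t ∈ Set.Icc 0 (tk k), CurvatureBoundedBy (g t) (cov t) (Qk k)) ∧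
        (∀ k, ∃ X Y Z W : TangentSpace (𝓡 4) (xk k),
          (g (tk k)).val (xk k) X X ≤ 1 ∧ (g (tk k)).val (xk k) Y Y ≤ 1 ∧
          (g (tk k)).val (xk k) Z Z ≤ 1 ∧ (g (tk k)).val (xk k) W W ≤ 1 ∧
          Qk k / 2 ≤ |(g (tk k)).curvatureForm (cov (tk k)) (xk k) X Y Z W|)

/-- The registered stub `stub_rescaledSequence` (r2) VERBATIM. VERDICT: TRUE — PROVED this cycle (sorry-free
candidate proof `RescaledSequence.lean` attached to the item; it needed the scale invariance
`μ(Qg, τ) = μ(g, τ/Q)`, ABSENT from the tree until this cycle and now LANDED as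
`Literature/Geometry/Riemannian/PerelmanEntropyScaling.lean` (`muEntropy_constSmul`, `muEntropy_constSmul'`,
`wEntropy_constSmul`, `isEntropyCompatible_constSmul_iff`; p71954), plus the in-file transport lemmas
`IsKappaNoncollapsed.comp_add_const` / `.mono_set` and the tree's `IsRicciFlow.parabolicRescale`,
`curvatureBoundedBy_constSmul_iff`, `IsKappaNoncollapsed.parabolicRescale`). Checked: `A_k = Q_k t_k ≥ k`; rescaled times
`s ∈ [−A_k, 0]` ↔ original `[0, t_k] ⊆ [0,T)`; `|Rm_{Qg}| = |Rm_g|/Q ≤ 1` on `Qg`-unit-bounded vectors; picked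
quadruple rescales to `≥ 1/2 =: c`; scales `r₀ < √A_k` ↔ original `r₀/√Q_k < √t_k < √T`; restricting the time
set preserves `IsKappaNoncollapsed`. As for 1a, the NLC output clause is derivable from the floor output
clause (§8.2) — the lead may delete the NLC thread from 1a/1c and feed `stub_blowdown` via
`stubBlowdown_nlc_of_floor`. -/
def StubRescaledSequence : Prop :=
    ∀ (M : Type) [TopologicalSpace M] [T2Space M] [SecondCountableTopology M]
      [ChartedSpace (EuclideanSpace ℝ (Fin 4)) M] [IsManifold (𝓡 4) ∞ M] [CompactSpace M]
      [ConnectedSpace M] [T3Space M] [MeasurableSpace M] [BorelSpace M] (T δ' κ : ℝ),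
      0 < δ' → 0 < κ →
      ∀ (g : ℝ → PseudoRiemannianMetric (𝓡 4) ∞ (EuclideanSpace ℝ (Fin 4)) (TangentSpace (𝓡 4) : M → Type _))
        (cov : ℝ → CovariantDerivative (𝓡 4) (EuclideanSpace ℝ (Fin 4)) (TangentSpace (𝓡 4) : M → Type _)),
      IsMaximalRicciFlow g cov T →
      (∀ r₀ : ℝ, 0 < r₀ → r₀ < Real.sqrt T → IsKappaNoncollapsed g cov (Set.Ico 0 T) κ r₀) →
      (∀ t ∈ Set.Ico 0 T, ∀ τ : ℝ, 0 < τ →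
        ((Real.log 2 + Real.log Real.pi / 2 - 3 / 2 + δ' : ℝ) : EReal) ≤ (g t).muEntropy (cov t) τ) →
      ∀ (tk Qk : ℕ → ℝ) (xk : ℕ → M),
      (∀ k, tk k ∈ Set.Ico 0 T) → (∀ k, 0 < Qk k) → (∀ k : ℕ, (k : ℝ) ≤ Qk k * tk k) →
      (∀ k, ∀ t ∈ Set.Icc 0 (tk k), CurvatureBoundedBy (g t) (cov t) (Qk k)) →
      (∀ k, ∃ X Y Z W : TangentSpace (𝓡 4) (xk k),
        (g (tk k)).val (xk k) X X ≤ 1 ∧ (g (tk k)).val (xk k) Y Y ≤ 1 ∧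
        (g (tk k)).val (xk k) Z Z ≤ 1 ∧ (g (tk k)).val (xk k) W W ≤ 1 ∧
        Qk k / 2 ≤ |(g (tk k)).curvatureForm (cov (tk k)) (xk k) X Y Z W|) →
      ∃ (κ' δ'' c : ℝ), 0 < κ' ∧ 0 < δ'' ∧ 0 < c ∧
        ∃ (A : ℕ → ℝ)
          (gk : ℕ → ℝ → PseudoRiemannianMetric (𝓡 4) ∞ (EuclideanSpace ℝ (Fin 4)) (TangentSpace (𝓡 4) : M → Type _))
          (covk : ℕ → ℝ → CovariantDerivative (𝓡 4) (EuclideanSpace ℝ (Fin 4)) (TangentSpace (𝓡 4) : M → Type _))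
          (xk' : ℕ → M),
          (∀ k : ℕ, (k : ℝ) ≤ A k) ∧
          (∀ k, IsRicciFlow (gk k) (covk k) (Set.Icc (-(A k)) 0)) ∧
          (∀ k, ∀ t ∈ Set.Icc (-(A k)) 0, (gk k t).IsRiemannian) ∧
          (∀ k, ∀ t ∈ Set.Icc (-(A k)) 0, CurvatureBoundedBy (gk k t) (covk k t) 1) ∧
          (∀ k, ∃ X Y Z W : TangentSpace (𝓡 4) (xk' k),
            (gk k 0).val (xk' k) X X ≤ 1 ∧ (gk k 0).val (xk' k) Y Y ≤ 1 ∧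
            (gk k 0).val (xk' k) Z Z ≤ 1 ∧ (gk k 0).val (xk' k) W W ≤ 1 ∧
            c ≤ |(gk k 0).curvatureForm (covk k 0) (xk' k) X Y Z W|) ∧
          (∀ k, ∀ r₀ : ℝ, 0 < r₀ → r₀ < Real.sqrt (A k) →
            IsKappaNoncollapsed (gk k) (covk k) (Set.Icc (-(A k)) 0) κ' r₀) ∧
          (∀ k, ∀ t ∈ Set.Icc (-(A k)) 0, ∀ τ : ℝ, 0 < τ →
            ((Real.log 2 + Real.log Real.pi / 2 - 3 / 2 + δ'' : ℝ) : EReal) ≤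
              (gk k t).muEntropy (covk k t) τ)

/-- The registered stub `stub_compactModelRecognition` (r2; shared with line spineless-models) VERBATIM.
VERDICT: TRUE — PROVED below (`stubCompactModelRecognition_holds`). -/
def StubCompactModelRecognition : Prop :=
    ∀ (N M : Type) [TopologicalSpace N] [T2Space N] [SecondCountableTopology N]
      [ChartedSpace (EuclideanSpace ℝ (Fin 4)) N] [IsManifold (𝓡 4) ∞ N] [CompactSpace N] [Nonempty N]
      [TopologicalSpace M] [T2Space M] [SecondCountableTopology M]
      [ChartedSpace (EuclideanSpace ℝ (Fin 4)) M] [IsManifold (𝓡 4) ∞ M] [ConnectedSpace M]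
      (φ : N → M), ContMDiff (𝓡 4) (𝓡 4) ∞ φ → Function.Injective φ →
      (∀ x : N, Function.Injective (mfderiv (𝓡 4) (𝓡 4) φ x)) →
      Nonempty (N ≃ₘ⟮𝓡 4, 𝓡 4⟯ M)

/-- **`stub_compactModelRecognition` holds** (Lee 2013 Thm 4.29 / Prop 4.8 / Thm 4.14): injective
differential in equal dimension ⇒ local diffeomorphism everywhere (tree IFT
`Literature.Topology.FourManifolds.isLocalDiffeomorphAt_of_mfderiv_injective`) ⇒ open map; the range is
compact hence closed, non-empty, so all of the connected `M`; a bijective local diffeomorphism is a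
diffeomorphism (`IsLocalDiffeomorph.diffeomorphOfBijective`). Candidate proof for the lead (also attached to
the item as `CompactModelRecognition.lean` in namespace `…AncientSphereRigidity`). [folklore] -/
theorem stubCompactModelRecognition_holds : StubCompactModelRecognition := by
  intro N M _ _ _ _ _ _ _ _ _ _ _ _ _ φ hφ hinj himm
  have hloc : IsLocalDiffeomorph (𝓡 4) (𝓡 4) ∞ φ := fun x ↦
    Literature.Topology.FourManifolds.isLocalDiffeomorphAt_of_mfderiv_injective
      isOpen_univ (mem_univ x) hφ.contMDiffOn (by simp) rfl (himm x)
  have hopen : IsOpen (range φ) := hloc.isLocalHomeomorph.isOpenMap.isOpen_range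
  have hclosed : IsClosed (range φ) := (isCompact_range hφ.continuous).isClosed
  have hsurj : Function.Surjective φ :=
    range_eq_univ.mp (IsClopen.eq_univ ⟨hclosed, hopen⟩ (range_nonempty φ))
  exact ⟨hloc.diffeomorphOfBijective ⟨hinj, hsurj⟩⟩

/-- With §8.4 the composition of the line needs only four stubs; and on any `M` admitting an injective
immersion of a compact shrinker `S` of the conclusion of `stub_blowdown`, `S ≅ M` — so for `M ≃ₕ S⁴` the
compact branch of the line is: blow-down compact ⇒ `M` itself carries a compact shrinker of density
`> Θ_cyl` ⇒ (`CompactShrinkerGap`) `M ≅ S⁴`. [folklore] -/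
theorem blowdownConclusion_compact_branch (M : Type) [TopologicalSpace M] [T2Space M]
    [SecondCountableTopology M] [ChartedSpace (EuclideanSpace ℝ (Fin 4)) M] [IsManifold (𝓡 4) ∞ M]
    [ConnectedSpace M] (h : BlowdownConclusion M) :
    ∃ (S : Type) (_ : TopologicalSpace S) (_ : T2Space S) (_ : SecondCountableTopology S)
      (_ : ChartedSpace (EuclideanSpace ℝ (Fin 4)) S) (_ : IsManifold (𝓡 4) ∞ S) (_ : ConnectedSpace S)
      (_ : T3Space S) (_ : MeasurableSpace S) (_ : BorelSpace S)
      (gS : PseudoRiemannianMetric (𝓡 4) ∞ (EuclideanSpace ℝ (Fin 4)) (TangentSpace (𝓡 4) : S → Type _))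
      (_ : gS.HasLeviCivita) (fS : S → ℝ) (hS : gS.IsRiemannian),
      (∀ (x : S) (r : NNReal), IsCompact {y : S | gS.edist hS x y ≤ r}) ∧
      ContMDiff (𝓡 4) 𝓘(ℝ, ℝ) ∞ fS ∧
      (∀ (x : S) (X Y : TangentSpace (𝓡 4) x),
        gS.ricci x X Y + gS.hessian fS x X Y = (1 / 2 : ℝ) * gS.val x X Y) ∧
      (∀ x : S, gS.scalarCurvature x + gS.gradSq fS x = fS x) ∧
      (∃ x : S, gS.scalarCurvature x ≠ 0) ∧
      ENNReal.ofReal (32 * Real.pi ^ 2 * Real.sqrt Real.pi * Real.exp (-(3 : ℝ) / 2)) <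
        ∫⁻ x, ENNReal.ofReal (Real.exp (-fS x))
          ∂(riemannianMeasure (gS.toContMDiffRiemannianMetric hS)) ∧
      (CompactSpace S → Nonempty (S ≃ₘ⟮𝓡 4, 𝓡 4⟯ M)) := by
  obtain ⟨S, i1, i2, i3, i4, i5, i6, i7, i8, i9, gS, iLC, fS, hS, h1, h2, h3, h4, h5, h6, h7⟩ := h
  refine ⟨S, i1, i2, i3, i4, i5, i6, i7, i8, i9, gS, iLC, fS, hS, h1, h2, h3, h4, h5, h6, fun hc ↦ ?_⟩
  obtain ⟨φ, hφ, hinj, himm⟩ := h7 hc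
  obtain ⟨x, _⟩ := h5
  haveI : Nonempty S := ⟨x⟩
  exact stubCompactModelRecognition_holds S M φ hφ hinj himm

/-! ### 8.5 Consequences of the round-sphere tightness in the vocabulary of §0–§3 -/

/-- Any threshold `c` the unit round `S⁴` clears with a positive gap is `< log 6 − 2 = ν_round`. [folklore] -/
theorem entropyAbove_round_lt {c : ℝ}
    (h : EntropyAbove (roundMetric (n := 4) EuclideanFive) isRiemannian_roundMetric c) :
    c < Real.log 6 - 2 := by
  obtain ⟨δ, hδ, H⟩ := h
  have := roundSphere_gap_le (c := c) (δ := δ) H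
  linarith

/-- **The round `S⁴` does NOT clear its own density**: `¬ EntropyAbove g_{S⁴} ν_round`. So the recogniser
`Recognition (log 6 − 2)` (threshold raised to the sphere's value; weaker than the crux, still SPC4-implied,
`recognition_mono`/`spc4_imp_recognition`) has lost its model witness — if the round metric maximises `ν` on
`S⁴` (CHI 2004: it is a local maximum) its hypothesis is vacuous. The usable thresholds are `[ν_cyl, ν_round)`. [folklore] -/
theorem not_entropyAbove_round_nuRound :
    ¬ EntropyAbove (roundMetric (n := 4) EuclideanFive) isRiemannian_roundMetric (Real.log 6 - 2) :=
  fun h ↦ lt_irrefl _ (entropyAbove_round_lt h)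

/-- The crux's gap for the round metric: `δ ≤ log 6 − 2 − ν_cyl` (`< 0.0267`, `gap_window`). [folklore] -/
theorem roundSphere_cruxGap_le {δ : ℝ}
    (h : ∀ τ : ℝ, 0 < τ → ∀ f : SphereFour → ℝ, ContMDiff (𝓡 4) 𝓘(ℝ, ℝ) ∞ f →
      ∫ x, (4 * Real.pi * τ) ^ (-(4 : ℝ) / 2) * Real.exp (-f x)
        ∂(riemannianMeasure ((roundMetric (n := 4) EuclideanFive).toContMDiffRiemannianMetric
          isRiemannian_roundMetric)) = 1 →
      nuCyl + δ ≤ ∫ x, (τ * ((roundMetric (n := 4) EuclideanFive).scalarCurvature x +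
          (roundMetric (n := 4) EuclideanFive).gradSq f x) + f x - 4) *
        ((4 * Real.pi * τ) ^ (-(4 : ℝ) / 2) * Real.exp (-f x))
        ∂(riemannianMeasure ((roundMetric (n := 4) EuclideanFive).toContMDiffRiemannianMetric
          isRiemannian_roundMetric))) :
    δ ≤ Real.log 6 - 2 - nuCyl := by
  have := roundSphere_gap_le (c := nuCyl) (δ := δ) h
  linarith

/-- **The window of admissible gaps**: `0.0258 < log 6 − 2 − ν_cyl < 0.0267` (true value `.02625`), from
`volRatio_window` (`Θ_cyl/Θ_sph ∈ (.974, .9742)`) and `1 − 1/x ≤ log x ≤ x − 1`. [folklore] -/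
theorem gap_window : 0.0258 < Real.log 6 - 2 - nuCyl ∧ Real.log 6 - 2 - nuCyl < 0.0267 := by
  have hc0 : 0 < thetaCyl := by unfold thetaCyl; positivity
  have hs0 : 0 < thetaSph := by unfold thetaSph; positivity
  have hr0 : 0 < thetaCyl / thetaSph := div_pos hc0 hs0
  obtain ⟨hlo, hhi⟩ := volRatio_window
  have hgap : Real.log 6 - 2 - nuCyl = -Real.log (thetaCyl / thetaSph) := by
    rw [nuCyl_eq_log_thetaCyl, ← log_thetaSph, Real.log_div hc0.ne' hs0.ne']; ring
  rw [hgap]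
  constructor
  · have h1 := Real.log_le_sub_one_of_pos hr0
    linarith
  · have h1 := Real.one_sub_inv_le_log_of_pos hr0
    have h2 : (thetaCyl / thetaSph)⁻¹ < (0.974 : ℝ)⁻¹ := by
      rw [inv_lt_inv₀ hr0 (by norm_num)]; exact hlo
    have h3 : (0.974 : ℝ)⁻¹ < 1.0267 := by norm_num
    linarith

end Targets

/-! ## §6 Mechanism notes (prose for the provers; nothing here is used above) -/

/-- MECHANISM NOTES (cycle 2).
1. WHAT KILLS THE PROOF BUT NOT THE STATEMENT. The intended proof needs NoncompactShrinkerGap (10868) and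
   CompactShrinkerGap (10870): a smooth non-flat 4-d gradient shrinker `N ≠ S⁴` with `Θ(N) ∈ (.791, 1)` breaks
   the proof; it breaks the CRUX only if in addition `N` is a compact shrinker structure on an exotic `S⁴`
   (then `N` itself, with `g`, is a counterexample: `R_N > 0`, `ν(g_N) = μ(g_N,1) = log Θ(N) > ν_cyl` by the
   homothetic-flow argument of §5). Known table (all certified orderings in §3; numerics: CHI 2004 §4, cycle-1
   toric computation kit j006074): S⁴ .8120 > S³×ℝ .7910 > S²×ℝ² = ℂ×ℙ¹ .7358 > FIK .6720 > ℂP² .6090 >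
   BCCD .5617 > S²×S² .5413 > Koiso–Cao .5179 > Page .517 > orbifold cones ≤ .5 > Wang–Zhu .4549 > ℝP⁴ .4060 >
   … ; Kähler sector COMPLETE (Li–Wang arXiv:2301.09784 Thm 1.1) with max non-flat value 2/e; non-Kähler
   non-compact sector: only S³/Γ×ℝ known; compact non-Einstein with b₂ = 0: none known, none excluded.
2. ORBIFOLDS are harmless: `Θ(N) ≤ 1/|Γ| ≤ 1/2 < Θ_cyl` (`half_lt_thetaCyl`).
3. ONLY ONE SCALE IS USED: monotonicity gives `𝒩_{x,T}(τ) ≥ μ(g(T−τ), τ) ≥ μ(g₀, T)`, so the proof consumes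
   `μ(g₀, T_sing) > ν_cyl` only (T_sing ≤ 2/R_min); `ν > ν_cyl` at scales `τ > 2/R_min` is idle. A planner could
   weaken the hypothesis to `∀ τ ≤ 2/R_min, μ(g,τ) ≥ ν_cyl + δ` without changing the mechanism.
4. STRICTNESS: with `≥ ν_cyl` (`RecognitionAtLeast nuCyl`, still SPC4-implied) the cylinder is admissible and the
   mechanism proves nothing; the statement stays unrefutable.
5. `R > 0`: idle for truth (λ > 0 from ν > −∞), used by type-split (scalar pinching) and for `T < ∞` cheaply.
6. `M ≃ₕ S⁴`: enters the proof only through CompactShrinkerGap (compact tangent flow ≅ M); for truth see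
   `ConnectedRecognition`.
7. MCF TEMPLATE: Bernstein–Wang (Invent. 2016 / Duke 2017): closed hypersurfaces of ℝ⁴ with entropy
   ≤ λ(S²×ℝ) are diffeomorphic to S³ — the exact analogue (sphere = entropy MINIMISER there, density MAXIMISER
   here); their proof needed the classification of low-entropy shrinkers (CIMW) + a topological argument for
   asymptotically conical ones — here: the two gaps + `end-density-ceiling`.
8. LITERATURE STATE (cycle 1 searches; cycle 2: searchd local index rc 75 23:05–23:55Z, arXiv cascade + galaxy up;
   read this cycle, page files in the seat's .lit/texts): Chow, *Ricci Solitons in Low Dimensions* (AMS GSM 2023) — no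
   density table / 4-d entropy-gap statement; Donovan arXiv:2503.15033 (J. Geom. Anal. 2025) — Conj. 1.5: a compact
   simply-connected cohomogeneity-one 4-d Ricci soliton is Koiso–Cao, Page, FS, round S⁴ or S²×S², with a DHW-type
   numerical shooting scan of every SU(2)/SO(3) action (incl. both actions on S⁴, §5.2: "the only smooth solitons
   suggested are the known Einstein metrics, the Koiso–Cao metric" + orbifold Kähler ones) — numerical SUPPORT for the
   compact gap on the standard S⁴ in the cohomogeneity-one sector (exotic spheres admit no such action); Naff–Ozuch
   arXiv:2509.05470 — FIK is linearly stable (a generic model, but Θ = .672 is outside the window); Chan–Zhang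
   arXiv:2605.08884 Thm 1.2/1.3 — local Ricci / ν gap theorems at the GAUSSIAN end, ε(n) inexplicit; Wu–Wu
   arXiv:2505.02315, Cao–Xie arXiv:2403.19627 — classifications under Ric ≥ 0 / half-PIC (curvature-conditioned, not
   entropy-conditioned). Net: no printed 4-d shrinker with Θ ∈ (.791, .812); no theorem `Θ(N⁴) ≤ Θ(S³×ℝ)` (non-compact)
   or `≤ Θ(S⁴)` (compact non-Einstein); rigidity of S³×ℝ (Li–Wang JDG 2024) and of Sⁿ (Kröncke, CHI) are local only.
9. COMPUTATION RECORD (cycle 2 re-certification, pure-python quadrature + golden-section, folder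
   compute/toric_density_recheck.py; agrees with cycle-1 kit job j006074 to 5 digits): toric Kähler shrinker density
   `Θ = e^{−2} min_ξ ∫_P e^{−⟨ξ,x⟩} dx` over the anticanonical polytope `P = {⟨u_i,x⟩ ≥ −1}` (Duistermaat–Heckman +
   the normalisation `∫(f − 2)e^{−f} = 0`; validated on ℂP² 4.5/e², ℙ¹×ℙ¹ 4/e², ℂ×ℙ¹ 2/e): FIK (`P = {x,y,x+y ≥ −1}`)
   `F(a,a) = e^a(1/a + 1/a²)`, min at `a = √2` ⇒ `Θ(FIK) = (1+√2)e^{√2−2}/2 = .67196` (CLOSED FORM, new; CHI's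
   numerical .672); BCCD (`P = {x ≥ −1, |y| ≤ 1, x+y ≥ −1}`) `.56174` at `ξ = (1.2876, .6438)` (ξ₁ = 2ξ₂);
   Koiso–Cao `.51787` (ξ = .5276); Wang–Zhu `.45485` (ξ = (.4347, 0)).
10. (cycle 3) NLC IS FREE: a uniform floor `μ(g(t), τ) ≥ m` for all `τ > 0` on closed slices gives
   `κ(m, n)`-noncollapsing at ALL scales (`isKappaNoncollapsed_of_muFloor`, §8.2) — for the picked line this
   removes Perelman's Thm 4.1 from `stub_singularFlow`, the NLC thread from `stub_rescaledSequence`, and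
   hypothesis (6) from `stub_blowdown` (`stubBlowdown_nlc_of_floor`); for Bamler's theory the floor is anyway
   consumed as a Nash-entropy lower bound `𝒩 ≥ μ ≥ ν_cyl + δ'`.
11. (cycle 3) DECOUPLING: the conclusion of `stub_blowdown` quantifies `∃ S …` with the ONLY link to the data
   being `CompactSpace S → S immerses injectively into M`; on `M ≅ S⁴` the round shrinker is a free witness
   (§8.1). Consequently no small/junk model of the HYPOTHESES of `stub_blowdown` on `M = S⁴` can ever refute it,
   and a refutation needs an `M ≇ S⁴` carrying admissible blow-up data (flows on `M × [−A_k, 0]`, `A_k → ∞`,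
   `|Rm| ≤ 1`, `|Rm(x_k,0)| ≥ c`, floor `> ν_cyl`) for which NO dense shrinker immerses — i.e. a failure of
   Bamler 2020a–c/BCDMZ bookkeeping itself. Junk candidates for such data were checked and all fail the FLOOR:
   static Ricci-flat slices (ν = log AVR ≤ log ½: a complete non-flat Ricci-flat 4-manifold with AVR > 0 has
   ∫|Rm|² < ∞ by Cheeger–Naber 2015 (codim-4, n = 4 energy bound), hence is ALE (Bando–Kasue–Nakajima 1989)
   with AVR = 1/|Γ| ≤ ½ < Θ_cyl — and closed flat/Ricci-flat `M` have `μ(g,τ) → −∞` as `τ → ∞`), Einstein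
   `λ > 0` flows other than the round one (Gursky: Θ ≤ .271), Kähler shrinker flows (Θ ≤ 2/e), cylinders /
   Bryant / Perelman's oval (ν = ν_cyl exactly, the strict floor fails), products and quotients (split lemma,
   Θ/|Γ|). The only admissible data known on any closed `M⁴` are rescalings of flows on `S⁴` near the round one.
   PREDICTION of the mechanism beyond homotopy spheres (falsifiable, for `ConnectedRecognition` §2): stubs + gaps
   give, for ANY closed connected `M⁴` carrying `R > 0`, `ν > ν_cyl`, a compact shrinker `S ≅ M` with
   `Θ(S) > Θ_cyl`; complete shrinkers have finite `π₁` (Wylie 2008) and the universal cover of `S` is a shrinker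
   of density `|π₁(M)|·Θ(S) > 2Θ_cyl = 1.58 > 1 ≥ Θ` unless `π₁ = 1`. So the line predicts `ν(g) ≤ ν_cyl` for
   EVERY `R > 0` metric on EVERY closed 4-manifold with `π₁ ≠ 1` (ℝP⁴, S³×S¹, lens-space bundles, …) — one
   such metric with `ν > ν_cyl` refutes NoncompactShrinkerGap ∨ the Bamler bookkeeping (not this crux).
16. (cycle 3) COMPUTATION — HOW FAT IS THE HYPOTHESIS? kit job j007798 (`compute/nu_ellipsoid.py`, numpy/scipy,
   N = 500 cells, 30+15 scales; table attached to the item as `nu_ellipsoid_j007798.txt`): `ν_sym(a) :=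
   inf_τ inf_{O(4)-invariant f} 𝒲` for the ellipsoids of revolution `S⁴(a) = {x₀²/a² + |x'|² = 1} ⊂ ℝ⁵`
   (an UPPER bound for `ν`; equality expected for prolate `a ≥ 1`, where the competitors are waist Gaussians).
   VALIDATION `a = 1`: `Vol − 8π²/3 = −4.5e−10`, `R ≡ 12`, `ν_sym − (log 6 − 2) = +6.2e−6`, `τ* = .1663 ≈ 1/6`.
   TABLE (margin := ν_sym − ν_cyl): a=.35 −.0407 | .5 −.0088 | .6 +.0060 | .7 +.0160 | .8 +.0223 | .9 +.0254 |
   .95 +.0261 | 1 +.0263 | 1.05 +.0261 | 1.1 +.0256 | 1.2 +.0239 | 1.35 +.0203 | 1.5 +.0164 | 1.75 +.0105 |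
   2 +.0062 | 2.5 +.0019 | 3 +.00056 | 4 +.00006 | 6 −.00007 (τ* ↑ .246 → 1/4 = the cylinder scale of the unit
   waist). READING: (i) the entropy clause of the crux / of ENT is an OPEN, FAT condition around the round metric —
   it survives prolate stretching up to aspect ≈ 4 and oblate squashing down to ≈ .55 (oblate `a ≤ .5` FAILS:
   certified modulo numerics, since ν_sym bounds ν from above); (ii) `ν_cyl` is EXACTLY the long-capsule limit:
   as `a → ∞` the waist of `S⁴(a)` is a unit `S³`-cylinder and `ν_sym(a) → ν_cyl⁺` with the minimiser the
   waist Gaussian at `τ = 1/4` — necks are precisely what `ν > ν_cyl` forbids, as the mechanism wants;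
   (iii) all admissible shapes have `R_min > 0` (convex), so the `R > 0` clause costs nothing here.
   So the hypothesis set of the crux on `S⁴` is far from thin; what is thin is only the WINDOW OF THRESHOLDS
   `[ν_cyl, ν_round)` (note 12), not the set of metrics clearing `ν_cyl`.
12. (cycle 3) TIGHTNESS: for the round metric the crux's `δ` is `< 0.0267` (`gap_window`), and
   `μ(g_{S⁴}, 1/6) ≤ log 6 − 2` is now a theorem in the crux's typing (`roundSphere_gap_le`); the reverse
   inequality (near-miss §5) still needs Perelman (T2) + the sharp Bakry–Émery LSI on `S⁴`
   (`4τ = 2/K` at `τ = 1/6`, `K = Ric = 3`), but NO LONGER the volume of `S⁴`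
   (`riemannianMeasure_roundMetric_sphere_four_univ` landed in `RoundSphereVolume.lean`).
13. (cycle 3) LITERATURE: no change to the density table. searchd (local+OpenAlex cascade) rc 75 / arXiv 0 rows
   this session; galaxy pdf intelligent sweep "known complete noncompact 4-d gradient shrinking solitons besides
   cylinders, and their Gaussian densities" (25 rows: Petersen–Wylie rigidity 2009, Conlon–Deruelle–Sun 1904.00147
   (Kähler, Θ ≤ 2/e sector), Conrado–Zhou 2309.16017 (Wasserstein on shrinkers), Isenberg–Knopf–Šešum PAMQ 2019
   (non-Kähler Type-I singularities modelled on FIK, Θ = .672), Bryant Kähler solitons, surveys) — no non-Kähler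
   non-compact 4-d shrinker other than S³/Γ×ℝ, no shrinker with Θ ∈ (.791, .812).
14. (cycle 3) LINE STATUS FOR THE LEAD: with 8.4 the skeleton reduces to `stub_singularFlow` + `stub_blowdown`;
   by 8.2 the NLC clause of `stub_singularFlow` can be fed from its own floor clause
   (`Negative.stubBlowdown_nlc_of_floor` / `isKappaNoncollapsed_of_muFloor`, landed p71784), so 1a needs exactly:
   maximal existence (`ricciFlow_shortTime_existence` ⇒ tree reductions), finite singular time
   (`ricciFlow_singularTime_le_holds`), curvature blow-up (`ricciFlow_curvature_blowup`), and the floor along the flow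
   = Perelman (T2) `μ(g₀, τ + t) ≤ μ(g(t), τ)` (named-fact shape `h₂` of `perelman_noLocalCollapsing_of_muBounds`).
15. (cycle 3) PRE-CONSULT MAP FOR `stub_blowdown` (what the lead's reshape will have to name, each with the cheapest
   way it could fail; none fails on inspection): B1 𝔽-(sub)compactness of `(M, g_k)` on `[−A_k, 0]` pointed at
   `(x_k, 0)` (Bamler 2020b; needs only `n = 4` and `A_k → ∞`). B2 `|Rm| ≤ 1` + uniform NLC ⇒ every point of the
   limit is regular, the limit is a smooth complete ancient flow `N` and the convergence is smooth
   (ε-regularity; Hamilton's limit) — fails only if curvature bounds did not pass to 𝔽-limits (they do).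
   B3 floor ⇒ `𝒩^k_{(x_k,0)}(τ) ≥ μ(g_k(−τ), τ) ≥ ν_cyl + δ'` for `τ ≤ A_k` (conjugate heat kernel is admissible:
   smooth, positive, mass 1 on closed `M`) and `𝒩` is continuous under 𝔽-convergence ⇒ `𝒩^N ≥ ν_cyl + δ'` at all
   scales. B4 tangent flow at `−∞` of `N` exists and is a metric soliton (2020c §2.7 Thm 2.40; `N` is an 𝔽-limit
   of compact flows with `𝒩 ≥ −Y`). B5 `n = 4`: the soliton is a smooth orbifold shrinker with isolated conical
   points, smooth convergence off them (2020c Thm 2.46 / BCDMZ Thm 2). B6 `log Θ(S) = 𝒩_∞ ≥ ν_cyl + δ'` and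
   `Θ(S) = (4π)⁻² ∫ e^{−f}` for the potential normalised by `R + |∇f|² = f` (uses `∫ (f − 2) e^{−f} = 0`,
   integration by parts with Gaussian decay on non-compact `S` — Carrillo–Ni / Li–Wang (2.5); the tree's
   `carrilloNi_muEntropy_eq_log_shrinkerDensity` is the CLOSED case only: a non-compact version is a fact to vend).
   B7 no conical point: `log Θ(S) = 𝒩_y(∞) ≤ 𝒩_y(0⁺) = −log |Γ_y|` at a conical point `y` (monotonicity of `𝒩`
   on the limit metric flow; `half_lt_thetaCyl`). B8 `Θ(S) < 1`: `𝒩^N < 0` strictly because `N` is non-flat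
   (`|Rm(x_∞, 0)| ≥ c`), and `𝒩` is non-increasing. B9 `R ≢ 0` on `S`: `R ≡ 0` on a complete shrinker forces
   the Gaussian soliton (`Θ = 1`), contradicting B8 (Chen 2009 `R ≥ 0`; strong maximum principle). B10 coupling:
   compact `S` ⇒ blow-downs converge smoothly and globally ⇒ `N ≅ S` compact ⇒ `(M, g_k(0)) → N` smoothly ⇒
   injective immersions `S → M` for `k ≫ 1`. Typing hazards for the reshape: keep every sub-stub over SEQUENCES OF
   COMPACT FLOWS or over Bamler's metric-flow vocabulary once it exists — a sub-stub quantifying over "every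
   complete ancient flow with (h1)–(h7)" re-imports the Chan–Ma–Zhang caveat; and keep `S`'s potential
   normalised by `R + |∇f|² = f` (the density clause is stated for THAT normalisation; with `∫(4π)⁻²e^{−f} = 1`
   instead it would read `0 < log Θ`-nonsense). -/
theorem mechanism_notes : True := trivial

end Summit.SmoothPoincare4.SmoothPoincare4.Cruxes.SubcylindricalRecognition.Disproof

end
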